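import Literature.Analysis.FluidPDE.CKNLocalRegularityRRSStep2
import HarnessLib

/-!
# A Caffarelli–Kohn–Nirenberg induction from the initial time, Step 2
(towards Barker–Prange 2020, Thm. 1 in the slab form used for Thm. 2)

Analysis/FluidPDE proofs file (theorems only, no definitions, no named facts) on the discharge
path of the named fact `Literature.Analysis.FluidPDE.BarkerPrange2020_thm2`
(`BarkerPrangeConcentration.lean`; T. Barker, C. Prange, Arch. Ration. Mech. Anal. 236 (2020) =
arXiv:1812.09115, Thm. 2), companion of `InitialTimeCKNStep3.lean` (see its module docstring
for the road taken: a Caffarelli–Kohn–Nirenberg induction from the initial time in the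
scale-invariant normalisation, for the zero extension to negative times of a local energy
solution, whose local energy inequality carries the datum term `∫ |u₀|² φ(0, ·)`).

This file proves **Step 2** of that induction, `{(A'_k)}_{1 ≤ k ≤ n} ⟹ (B'_{n+1})`
(Robinson–Rodrigo–Sadowski 2016, proof of Thm. 15.3, Step 2, pp. 221–223, run with
`(A'_k) : C(r_k) + D_osc(r_k) ≤ ε₀^{2/3}` and concluding
`(B'_{n+1}) : A_ess(r_{n+1}) + E(r_{n+1}) ≤ C_B ε₀^{2/3}`), for triples `(u, p, G)` on a unit
cylinder `Q_1(z₀)` having all the properties of a suitable pair (`RRS2016.IsSuitablePair`: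
classes, weak gradient, `div u = 0`, pressure equation) **except** that the local energy
inequality holds with a datum term,

  `2 ∫∫ |G|² φ ≤ ∫ |u₀|² φ(0, ·) + ∫∫ (|u|²(φₜ + Δφ) + (|u|² + 2p) u·∇φ)`  (`φ ≥ 0` a test on `Q_1(z₀)`),

where the datum `u₀` satisfies the Morrey-type smallness `∫_{B_ρ(a)} |u₀|² ≤ N ρ` (`0 < ρ ≤ 1`)
at the centre `a` of the induction, `N ≤ ε₀^{2/3}`:

* `BarkerPrange2020.ae_localEnergy_slice_of_integrable_datum` — the structure-free slicing of
  such an inequality (the proof of `ae_localEnergy_slice_of_integrable` with the datum term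
  carried along: the time cut-offs `η_ε ∈ [0, 1]` only decrease it);
* `BarkerPrange2020.ae_localEnergy_slice_datum_of_forall_lt` — the sliced inequality below a
  time level for tests supported in `Q` below every `τ < T`;
* the ring sums in the scale-invariant normalisation (`lintegral_cube_le_of_hypA'`,
  `lintegral_presOsc_le_of_hypA'`, `lintegral_vel_presOsc_le'`, `lintegral_cube_grad_le'`,
  `pressure_presTest_bound_of_le`, `abs_setIntegral_cubic_le'`, `abs_setIntegral_pressure_le'`):
  with `∫∫_{Q_{r_k}} |u|³, ∫∫_{Q_{r_k}} |p - (p)_{r_k}|^{3/2} ≤ ε₀^{2/3} r_k²` the cubic term against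
  `|∇φ_{n+1}| ≲ C₁ r² r_k⁻⁴` sums to `Σ_k 16 C₁ ε₀^{2/3} r² r_k⁻² ≤ (16/3) C₁ ε₀^{2/3}` plus the core
  `4 C₁ ε₀^{2/3}`, and the telescoped pressure term to `Σ_k c' C₁ r² r_k⁻² ε₀^{2/3} ≤ c' C₁ ε₀^{2/3}` —
  bounded, not decaying, which is all the scale-invariant induction needs;
* `BarkerPrange2020.lintegral_datum_le` — **the datum term is scale-invariantly small**:
  `∫ |u₀|² φ_{n+1}(0, ·) ≤ 4 C₁ N` (the slice `{t = 0}` of the ring decomposition of `Q_{1/2}(z)`: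
  on the core `φ ≤ C₁ r⁻¹` against `∫_{B_r} |u₀|² ≤ N r`, on the `j`-th ring `φ ≤ C₁ r² r_{j+1}⁻³`
  against `∫_{B_{r_j}} |u₀|² ≤ N r_j`, and `Σ_j 8 C₁ N r² r_j⁻² ≤ (8/3) C₁ N`);
* `BarkerPrange2020.initialStep2` — Step 2 itself, with `C_B = C₁² (3/2) (42 + 2c')`,
  `c' = 256 + 136 c_χ` (`C₁` from Lemma 15.11, `c_χ` the gradient bound of the cylinder cut-offs).

## References

* T. Barker, C. Prange, Arch. Ration. Mech. Anal. 236 (2020) = arXiv:1812.09115, Thm. 1, §4.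
  [BarkerPrange2020]
* J. C. Robinson, J. L. Rodrigo, W. Sadowski, *The three-dimensional Navier–Stokes equations*,
  CUP (2016), proof of Thm. 15.3, Step 2 (pp. 221–223), Lemma 15.11. [RobinsonRodrigoSadowski2016]
* L. Caffarelli, R. Kohn, L. Nirenberg, Comm. Pure Appl. Math. 35 (1982), Proposition 1, (2.5).
-/

noncomputable section

open MeasureTheory Set Function Filter Topology TopologicalSpace Metric
open scoped NNReal ENNReal InnerProductSpace RealInnerProductSpace Laplacian

namespace Literature.Analysis.FluidPDE

namespace BarkerPrange2020

open RRS2016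

/-! ### Slicing a local energy inequality with a datum term -/

section SliceDatum

variable {E : Type*} [NormedAddCommGroup E] [InnerProductSpace ℝ E] [FiniteDimensional ℝ E]
  [MeasurableSpace E] [BorelSpace E]
variable {Q : Opens (ℝ × E)} {ν : ℝ} {u : ℝ → E → E} {u₀ : E → E} {p : ℝ → E → ℝ}
  {G : ℝ → E → E →L[ℝ] E}

/-- **The sliced local energy inequality from the integrated one with a datum term**
(structure-free): if for all nonnegative tests `φ` on `Q`
`2ν ∫∫ |G|²φ ≤ ∫ |u₀|² φ(0,·) + ∫∫ (|u|²(φₜ + νΔφ) + (|u|² + 2p) u·∇φ)`, and for the given `φ ≥ 0`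
the functions `|u|²φ`, `|G|²φ` and the right-hand integrand are integrable, then for a.e. `s`,
`∫ |u(s)|² φ(s) + 2ν ∫∫_{t<s} |G|²φ ≤ ∫ |u₀|² φ(0,·) + ∫∫_{t<s} (|u|²(φₜ + νΔφ) + (|u|² + 2p) u·∇φ)`
(the proof of the accepted `ae_localEnergy_slice_of_integrable`, the time cut-offs
`η_ε ∈ [0,1]` multiplying the datum term by `η_ε(0) ≤ 1`). [cite: CaffarelliKohnNirenberg1982, (2.5); LemarieRieusset2016, (13.24) p. 467] -/
theorem ae_localEnergy_slice_of_integrable_datum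
    (hLEI : ∀ φ : ℝ → E → ℝ, IsSpaceTimeTestOn Q φ → (∀ t x, 0 ≤ φ t x) →
      2 * ν * ∫ t, ∫ x, frobeniusNormSq (G t x) * φ t x ≤
        (∫ x, ‖u₀ x‖ ^ 2 * φ 0 x) +
        ∫ t, ∫ x, (‖u t x‖ ^ 2 * (timeDeriv φ t x + ν * Δ (φ t) x) +
          (‖u t x‖ ^ 2 + 2 * p t x) * ⟪u t x, gradient (φ t) x⟫))
    {φ : ℝ → E → ℝ} (hφ : IsSpaceTimeTestOn Q φ) (hφ0 : ∀ t x, 0 ≤ φ t x)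
    (hIW : Integrable (fun z : ℝ × E => ‖u z.1 z.2‖ ^ 2 * φ z.1 z.2) (volume : Measure (ℝ × E)))
    (hIF : Integrable (fun z : ℝ × E => frobeniusNormSq (G z.1 z.2) * φ z.1 z.2)
      (volume : Measure (ℝ × E)))
    (hIR : Integrable (fun z : ℝ × E =>
      ‖u z.1 z.2‖ ^ 2 * (timeDeriv φ z.1 z.2 + ν * Δ (φ z.1) z.2) +
        (‖u z.1 z.2‖ ^ 2 + 2 * p z.1 z.2) * ⟪u z.1 z.2, gradient (φ z.1) z.2⟫) (volume : Measure (ℝ × E))) :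
    ∀ᵐ s ∂(volume : Measure ℝ),
      (∫ x, ‖u s x‖ ^ 2 * φ s x) +
          2 * ν * ∫ z in {z : ℝ × E | z.1 < s}, frobeniusNormSq (G z.1 z.2) * φ z.1 z.2 ≤
        (∫ x, ‖u₀ x‖ ^ 2 * φ 0 x) +
        ∫ z in {z : ℝ × E | z.1 < s}, (‖u z.1 z.2‖ ^ 2 * (timeDeriv φ z.1 z.2 + ν * Δ (φ z.1) z.2) +
          (‖u z.1 z.2‖ ^ 2 + 2 * p z.1 z.2) * ⟪u z.1 z.2, gradient (φ z.1) z.2⟫) := by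
  -- the integrable pieces
  set R : ℝ × E → ℝ := fun z => ‖u z.1 z.2‖ ^ 2 * (timeDeriv φ z.1 z.2 + ν * Δ (φ z.1) z.2) +
      (‖u z.1 z.2‖ ^ 2 + 2 * p z.1 z.2) * ⟪u z.1 z.2, gradient (φ z.1) z.2⟫ with hR
  set W : ℝ × E → ℝ := fun z => ‖u z.1 z.2‖ ^ 2 * φ z.1 z.2 with hW
  set F₀ : ℝ × E → ℝ := fun z => frobeniusNormSq (G z.1 z.2) * φ z.1 z.2 with hF₀
  set D : ℝ := ∫ x, ‖u₀ x‖ ^ 2 * φ 0 x with hD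
  have hD0 : 0 ≤ D := integral_nonneg fun x => mul_nonneg (sq_nonneg _) (hφ0 _ _)
  -- Lebesgue points of `U(t) = ∫ |u(t)|² φ(t) dx`
  set U : ℝ → ℝ := fun t => ∫ x, W (t, x) with hU
  have hIU : Integrable U (volume : Measure ℝ) := hIW.integral_prod_left
  have hLeb := IsUnifLocDoublingMeasure.ae_tendsto_average_norm_sub (μ := (volume : Measure ℝ))
    hIU.locallyIntegrable 2
  -- cut-offs
  obtain ⟨C, -, hcut⟩ := exists_time_cutoff
  have hmeasS : ∀ s : ℝ, MeasurableSet {z : ℝ × E | z.1 < s} := fun s =>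
    measurableSet_lt measurable_fst measurable_const
  filter_upwards [hLeb] with s hs
  -- the cut-off sequence at `s`
  set ε : ℕ → ℝ := fun n => 1 / ((n : ℝ) + 1) with hε
  have hεpos : ∀ n, 0 < ε n := fun n => Nat.one_div_pos_of_nat
  have hε0 : Tendsto ε atTop (𝓝 0) := tendsto_one_div_add_atTop_nhds_zero_nat
  choose η k hηs hη01 hη1 hη0 hηd hkc hkb hks hk1 using fun n => hcut s (ε n) (hεpos n)
  have hηc : ∀ n, Continuous fun z : ℝ × E => η n z.1 := fun n =>
    (hηs n).continuous.comp continuous_fst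
  have hηb : ∀ n (z : ℝ × E), ‖η n z.1‖ ≤ 1 := fun n z => by
    rw [Real.norm_eq_abs, abs_of_nonneg (hη01 n z.1).1]; exact (hη01 n z.1).2
  have hint1 : ∀ n, Integrable (fun z : ℝ × E => η n z.1 * F₀ z) (volume : Measure (ℝ × E)) :=
    fun n => hIF.bdd_mul (hηc n).aestronglyMeasurable (Eventually.of_forall (hηb n))
  have hint2 : ∀ n, Integrable (fun z : ℝ × E => η n z.1 * R z) (volume : Measure (ℝ × E)) :=
    fun n => hIR.bdd_mul (hηc n).aestronglyMeasurable (Eventually.of_forall (hηb n))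
  have hint3 : ∀ n, Integrable (fun z : ℝ × E => k n z.1 * W z) (volume : Measure (ℝ × E)) :=
    fun n => hIW.bdd_mul ((hkc n).comp continuous_fst).aestronglyMeasurable
      (Eventually.of_forall fun z => by rw [Real.norm_eq_abs]; exact hkb n z.1)
  -- the local energy inequality for `ηₙ φ`
  have hstep : ∀ n, (∫ t, k n t * U t) + 2 * ν * ∫ z, η n z.1 * F₀ z ≤ D + ∫ z, η n z.1 * R z := by
    intro n
    have hΦ : IsSpaceTimeTestOn Q (fun t x => η n t * φ t x) := hφ.time_mul (hηs n)
    have hΦ0 : ∀ t x, 0 ≤ η n t * φ t x := fun t x => mul_nonneg (hη01 n t).1 (hφ0 t x)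
    have hL := hLEI _ hΦ hΦ0
    -- the datum term only decreases
    have hDn : (∫ x, ‖u₀ x‖ ^ 2 * (η n 0 * φ 0 x)) ≤ D := by
      have e : (∫ x, ‖u₀ x‖ ^ 2 * (η n 0 * φ 0 x)) = η n 0 * D := by
        rw [hD, ← integral_const_mul]
        exact integral_congr_ae (Eventually.of_forall fun x => by ring)
      rw [e]
      calc η n 0 * D ≤ 1 * D := mul_le_mul_of_nonneg_right (hη01 n 0).2 hD0
        _ = D := one_mul D
    -- derivatives of the product
    have hT : ∀ t x, timeDeriv (fun t x => η n t * φ t x) t x =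
        η n t * timeDeriv φ t x - k n t * φ t x := by
      intro t x
      have hd : HasDerivAt (fun s => η n s * φ s x)
          (-k n t * φ t x + η n t * timeDeriv φ t x) t :=
        (hηd n t).mul (hφ.hasDerivAt_time t x)
      rw [timeDeriv, hd.deriv]
      ring
    have hLap : ∀ t x, Δ ((fun t x => η n t * φ t x) t) x = η n t * Δ (φ t) x := by
      intro t x
      have e : (fun x => η n t * φ t x) = (η n t) • (φ t) := by
        funext y; simp only [Pi.smul_apply, smul_eq_mul]
      have h2 : ContDiffAt ℝ 2 (φ t) x := (contDiff_infty.1 (hφ.contDiff_slice t) 2).contDiffAt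
      show Δ (fun x => η n t * φ t x) x = _
      rw [e, InnerProductSpace.laplacian_smul _ h2, smul_eq_mul]
    have hgr : ∀ t x, gradient ((fun t x => η n t * φ t x) t) x = η n t • gradient (φ t) x := by
      intro t x
      have hd : DifferentiableAt ℝ (φ t) x :=
        ((hφ.contDiff_slice t).differentiable (by simp)).differentiableAt
      show gradient (fun x => η n t * φ t x) x = _
      rw [gradient, gradient, fderiv_const_mul hd, map_smul]
    simp only [hT, hLap, hgr, real_inner_smul_right] at hL
    -- both sides as integrals over `ℝ × E`
    have e1 : (∫ t, ∫ x, frobeniusNormSq (G t x) * (η n t * φ t x)) = ∫ z, η n z.1 * F₀ z := by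
      rw [Measure.volume_eq_prod, integral_prod _ (hint1 n)]
      refine integral_congr_ae (Eventually.of_forall fun t => integral_congr_ae
        (Eventually.of_forall fun x => ?_))
      simp only [hF₀]; ring
    have e2 : (∫ t, ∫ x, (‖u t x‖ ^ 2 * (η n t * timeDeriv φ t x - k n t * φ t x +
          ν * (η n t * Δ (φ t) x)) +
        (‖u t x‖ ^ 2 + 2 * p t x) * (η n t * ⟪u t x, gradient (φ t) x⟫))) =
        (∫ z, η n z.1 * R z) - ∫ z, k n z.1 * W z := by
      have hsub : Integrable (fun z : ℝ × E => η n z.1 * R z - k n z.1 * W z)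
          (volume : Measure (ℝ × E)) := (hint2 n).sub (hint3 n)
      rw [← integral_sub (hint2 n) (hint3 n), Measure.volume_eq_prod,
        integral_prod (fun z : ℝ × E => η n z.1 * R z - k n z.1 * W z) hsub]
      refine integral_congr_ae (Eventually.of_forall fun t => integral_congr_ae
        (Eventually.of_forall fun x => ?_))
      simp only [hR, hW]; ring
    have e3 : ∫ z, k n z.1 * W z = ∫ t, k n t * U t := by
      rw [Measure.volume_eq_prod, integral_prod _ (hint3 n)]
      refine integral_congr_ae (Eventually.of_forall fun t => ?_)
      simp only [hU, ← integral_const_mul]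
    rw [e1, e2, e3] at hL
    linarith
  -- the three limits
  have hlimR : Tendsto (fun n => ∫ z, η n z.1 * R z) atTop (𝓝 (∫ z in {z : ℝ × E | z.1 < s}, R z)) := by
    rw [← integral_indicator (hmeasS s)]
    refine tendsto_integral_of_dominated_convergence (fun z => ‖R z‖)
      (fun n => (hint2 n).aestronglyMeasurable) hIR.norm
      (fun n => Eventually.of_forall fun z => ?_) (Eventually.of_forall fun z => ?_)
    · rw [norm_mul]
      exact mul_le_of_le_one_left (norm_nonneg _) (hηb n z)
    · have := (tendsto_cutoff_indicator hεpos hε0 (hη1) (hη0) z.1).mul_const (R z)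
      refine this.congr' (Eventually.of_forall fun n => rfl) |>.trans ?_
      by_cases hz : z.1 < s
      · rw [indicator_of_mem (mem_Iio.2 hz), indicator_of_mem (show z ∈ {z : ℝ × E | z.1 < s} from hz),
          one_mul]
      · rw [indicator_of_notMem (fun h' => hz (mem_Iio.1 h')),
          indicator_of_notMem (show z ∉ {z : ℝ × E | z.1 < s} from hz), zero_mul]
  have hlimF : Tendsto (fun n => ∫ z, η n z.1 * F₀ z) atTop
      (𝓝 (∫ z in {z : ℝ × E | z.1 < s}, F₀ z)) := by
    rw [← integral_indicator (hmeasS s)]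
    refine tendsto_integral_of_dominated_convergence (fun z => ‖F₀ z‖)
      (fun n => (hint1 n).aestronglyMeasurable) hIF.norm
      (fun n => Eventually.of_forall fun z => ?_) (Eventually.of_forall fun z => ?_)
    · rw [norm_mul]
      exact mul_le_of_le_one_left (norm_nonneg _) (hηb n z)
    · have := (tendsto_cutoff_indicator hεpos hε0 (hη1) (hη0) z.1).mul_const (F₀ z)
      refine this.congr' (Eventually.of_forall fun n => rfl) |>.trans ?_
      by_cases hz : z.1 < s
      · rw [indicator_of_mem (mem_Iio.2 hz), indicator_of_mem (show z ∈ {z : ℝ × E | z.1 < s} from hz),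
          one_mul]
      · rw [indicator_of_notMem (fun h' => hz (mem_Iio.1 h')),
          indicator_of_notMem (show z ∉ {z : ℝ × E | z.1 < s} from hz), zero_mul]
  have hlimU : Tendsto (fun n => ∫ t, k n t * U t) atTop (𝓝 (U s)) :=
    tendsto_integral_kernel_mul_of_lebesguePoint hIU (fun w δ hδ hm => hs w δ hδ hm) hεpos hε0
      hkc hkb hks hk1
  -- pass to the limit
  exact le_of_tendsto_of_tendsto' (hlimU.add (hlimF.const_mul (2 * ν)))
    (tendsto_const_nhds.add hlimR) hstep

/-- **Smooth time cut-offs at a level, with values in `[0, 1]`.** For `δ > 0` there is a smooth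
`θ : ℝ → ℝ`, `0 ≤ θ ≤ 1`, with `θ = 1` on `(-∞, T - 3δ]`, `θ = 0` on `[T - δ, ∞)` (the accepted
`exists_time_level_cutoff`, keeping the upper bound of `exists_smooth_time_cutoff`). [folklore] -/
theorem exists_time_level_cutoff_le_one (T : ℝ) {δ : ℝ} (hδ : 0 < δ) :
    ∃ θ ρ : ℝ → ℝ, ContDiff ℝ (⊤ : ℕ∞) θ ∧ (∀ t, HasDerivAt θ (ρ t) t) ∧
      (∀ t, t ≤ T - 3 * δ → θ t = 1) ∧ (∀ t, T - δ ≤ t → θ t = 0) ∧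
      (∀ t, t < T - 3 * δ → ρ t = 0) ∧ (∀ t, 0 ≤ θ t) ∧ (∀ t, θ t ≤ 1) := by
  obtain ⟨η, ρ, hηs, -, hηd, hη0, hη1, hη01, -, hρ0, -⟩ := exists_smooth_time_cutoff hδ
  refine ⟨fun t => η (T - t), fun t => -ρ (T - t), hηs.comp (contDiff_const.sub contDiff_id),
    fun t => ?_, fun t ht => hη1 _ (by linarith), fun t ht => hη0 _ (by linarith),
    fun t ht => ?_, fun t => (hη01 _).1, fun t => (hη01 _).2⟩
  · have h1 : HasDerivAt (fun t : ℝ => T - t) (-1) t := by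
      simpa using (hasDerivAt_id t).const_sub T
    have h2 : HasDerivAt (fun t => η (T - t)) (ρ (T - t) * -1) t := (hηd (T - t)).comp t h1
    simpa using h2
  · show -ρ (T - t) = 0
    rw [hρ0 _ (fun h => by linarith [h.2]), neg_zero]

/-- **Integrability of the right-hand side of the local energy inequality** (no force) from the
local integrability of `|u|²` and of the flux `(|u|² + 2p) u` on `Q`, for a test `ζ` on `Q`
(the proof of the accepted `IsSuitablePair.integrable_localEnergyRHS`). [folklore] -/
theorem integrable_localEnergyRHS_of_locallyIntegrableOn
    (hsq : LocallyIntegrableOn (fun z : ℝ × E => ‖u z.1 z.2‖ ^ 2) (Q : Set (ℝ × E)) volume)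
    (hcub : LocallyIntegrableOn (uncurry fun t x => (‖u t x‖ ^ 2 + 2 * p t x) • u t x)
      (Q : Set (ℝ × E)) volume)
    {ζ : ℝ → E → ℝ} (hζ : IsSpaceTimeTestOn Q ζ) :
    Integrable (localEnergyRHS ν 0 u p ζ) (volume : Measure (ℝ × E)) := by
  set K := tsupport (uncurry ζ) with hK
  have hKc : IsCompact K := hζ.hasCompactSupport
  have hKQ : K ⊆ (Q : Set (ℝ × E)) := hζ.tsupport_subset
  have hζ' : IsSpaceTimeTestOn (⊤ : Opens (ℝ × E)) ζ := hζ.mono le_top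
  have hcT : Continuous fun z : ℝ × E => timeDeriv ζ z.1 z.2 :=
    hζ'.timeDeriv_top.contDiff.continuous
  have hcL : Continuous fun z : ℝ × E => Δ (ζ z.1) z.2 :=
    hζ'.laplacian_top.contDiff.continuous
  obtain ⟨hcg, -, hg0⟩ := hζ.continuous_gradient_field
  have hTK : ∀ z ∉ K, timeDeriv ζ z.1 z.2 = 0 := fun z hz =>
    IsSpaceTimeTestOn.timeDeriv_eq_zero_of_notMem hz
  have hLK : ∀ z ∉ K, Δ (ζ z.1) z.2 = 0 := fun z hz =>
    laplacian_eq_zero_of_notMem_tsupport (notMem_tsupport_slice hz)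
  have h1 : Integrable (fun z : ℝ × E =>
      ‖u z.1 z.2‖ ^ 2 * (timeDeriv ζ z.1 z.2 + ν * Δ (ζ z.1) z.2))
      (volume : Measure (ℝ × E)) :=
    integrable_mul_of_locallyIntegrableOn hsq
      (hcT.add (continuous_const.mul hcL)) hKc hKQ fun z hz => by rw [hTK z hz, hLK z hz]; ring
  have h2 : Integrable (fun z : ℝ × E =>
      ⟪(fun t x => (‖u t x‖ ^ 2 + 2 * p t x) • u t x) z.1 z.2, gradient (ζ z.1) z.2⟫)
      (volume : Measure (ℝ × E)) :=
    integrable_inner_of_locallyIntegrableOn hcub hcg hKc hKQ hg0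
  refine (h1.add h2).congr (Eventually.of_forall fun z => ?_)
  simp only [localEnergyRHS, real_inner_smul_left, Pi.add_apply, Pi.zero_apply, inner_zero_left,
    zero_mul, mul_zero, add_zero]

/-- **The sliced inequality with a datum term, below a time level.** Under the integrated local
energy inequality with the datum term on `Q` (no force), with `|u|²`, `|G|²` and the flux
`(|u|² + 2p) u` locally integrable on `Q`: for a smooth compactly supported `ζ ≥ 0` on space–time
supported in `Q` below every level `τ < T`, for a.e. `s < T`,
`∫ |u(s)|² ζ(s) + 2ν ∫∫_{t<s} |G|² ζ ≤ ∫ |u₀|² ζ(0,·) + ∫∫_{t<s} R[ζ]` (`R = localEnergyRHS ν 0 u p ζ`), and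
the datum term is absent when `T ≤ 0` (the cut-offs at the level `T` vanish at `t = 0`). [cite: RobinsonRodrigoSadowski2016, (15.8) p. 215] -/
theorem ae_localEnergy_slice_datum_of_forall_lt
    (hLEI : ∀ φ : ℝ → E → ℝ, IsSpaceTimeTestOn Q φ → (∀ t x, 0 ≤ φ t x) →
      2 * ν * ∫ t, ∫ x, frobeniusNormSq (G t x) * φ t x ≤
        (∫ x, ‖u₀ x‖ ^ 2 * φ 0 x) +
        ∫ t, ∫ x, (‖u t x‖ ^ 2 * (timeDeriv φ t x + ν * Δ (φ t) x) +
          (‖u t x‖ ^ 2 + 2 * p t x) * ⟪u t x, gradient (φ t) x⟫))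
    (hsq : LocallyIntegrableOn (fun z : ℝ × E => ‖u z.1 z.2‖ ^ 2) (Q : Set (ℝ × E)) volume)
    (hGl : LocallyIntegrableOn (fun z : ℝ × E => frobeniusNormSq (G z.1 z.2)) (Q : Set (ℝ × E)) volume)
    (hcub : LocallyIntegrableOn (uncurry fun t x => (‖u t x‖ ^ 2 + 2 * p t x) • u t x)
      (Q : Set (ℝ × E)) volume)
    {ζ : ℝ → E → ℝ} (hζ : IsSpaceTimeTestOn (⊤ : Opens (ℝ × E)) ζ) (hζ0 : ∀ t x, 0 ≤ ζ t x)
    {T : ℝ} (hζQ : ∀ τ < T, tsupport (uncurry ζ) ∩ {z | z.1 ≤ τ} ⊆ (Q : Set (ℝ × E))) :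
    ∀ᵐ s ∂(volume : Measure ℝ), s < T →
      (∫ x, ‖u s x‖ ^ 2 * ζ s x) +
          2 * ν * ∫ z in {z : ℝ × E | z.1 < s}, frobeniusNormSq (G z.1 z.2) * ζ z.1 z.2 ≤
        (if 0 < T then (∫ x, ‖u₀ x‖ ^ 2 * ζ 0 x) else 0) +
        ∫ z in {z : ℝ × E | z.1 < s}, localEnergyRHS ν 0 u p ζ z := by
  set δ : ℕ → ℝ := fun k => 1 / ((k : ℝ) + 1) with hδ
  have hδ0 : ∀ k, 0 < δ k := fun k => by positivity
  choose θ ρ hθs hθd hθ1 hθ0 hρ0 hθnn hθle using fun k => exists_time_level_cutoff_le_one T (hδ0 k)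
  have htest : ∀ k, IsSpaceTimeTestOn Q (fun t x => θ k t * ζ t x) := fun k =>
    hζ.time_mul_of_forall_lt hζQ (hθs k) (by linarith [hδ0 k]) (hθ0 k)
  have hD0 : 0 ≤ ∫ x, ‖u₀ x‖ ^ 2 * ζ 0 x :=
    integral_nonneg fun x => mul_nonneg (sq_nonneg _) (hζ0 _ _)
  -- integrability of the pieces for a test `Φ` on `Q`
  have hpieces : ∀ Φ : ℝ → E → ℝ, IsSpaceTimeTestOn Q Φ →
      Integrable (fun z : ℝ × E => ‖u z.1 z.2‖ ^ 2 * Φ z.1 z.2) (volume : Measure (ℝ × E)) ∧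
      Integrable (fun z : ℝ × E => frobeniusNormSq (G z.1 z.2) * Φ z.1 z.2) (volume : Measure (ℝ × E)) := by
    intro Φ hΦ
    set K := tsupport (uncurry Φ) with hK
    have hKc : IsCompact K := hΦ.hasCompactSupport
    have hKQ : K ⊆ (Q : Set (ℝ × E)) := hΦ.tsupport_subset
    have hcΦ : Continuous fun z : ℝ × E => Φ z.1 z.2 := hΦ.contDiff.continuous
    have hΦK : ∀ z ∉ K, Φ z.1 z.2 = 0 := fun z hz =>
      show uncurry Φ z = 0 from image_eq_zero_of_notMem_tsupport hz
    exact ⟨integrable_mul_of_locallyIntegrableOn hsq hcΦ hKc hKQ hΦK,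
      integrable_mul_of_locallyIntegrableOn hGl hcΦ hKc hKQ hΦK⟩
  -- the sliced inequality for each `θ_k ζ`
  have hae := ae_all_iff.2 fun k => by
    have hΦ := htest k
    have hΦ0 : ∀ t x, 0 ≤ θ k t * ζ t x := fun t x => mul_nonneg (hθnn k t) (hζ0 t x)
    have hIR := integrable_localEnergyRHS_of_locallyIntegrableOn (ν := ν) hsq hcub hΦ
    have hIR' : Integrable (fun z : ℝ × E =>
        ‖u z.1 z.2‖ ^ 2 * (timeDeriv (fun t x => θ k t * ζ t x) z.1 z.2 +
          ν * Δ ((fun t x => θ k t * ζ t x) z.1) z.2) +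
        (‖u z.1 z.2‖ ^ 2 + 2 * p z.1 z.2) *
          ⟪u z.1 z.2, gradient ((fun t x => θ k t * ζ t x) z.1) z.2⟫) (volume : Measure (ℝ × E)) := by
      refine hIR.congr (Eventually.of_forall fun z => ?_)
      simp only [localEnergyRHS, Pi.zero_apply, inner_zero_left, zero_mul, mul_zero, add_zero]
    exact ae_localEnergy_slice_of_integrable_datum hLEI hΦ hΦ0 (hpieces _ hΦ).1 (hpieces _ hΦ).2 hIR'
  have hmeas : ∀ s : ℝ, MeasurableSet {z : ℝ × E | z.1 < s} := fun s =>
    measurableSet_lt measurable_fst measurable_const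
  filter_upwards [hae] with s hs' hsT
  obtain ⟨k, hk⟩ := exists_nat_one_div_lt (show 0 < (T - s) / 3 by linarith)
  have hk' : s < T - 3 * δ k := by
    simp only [hδ]
    linarith
  have h1 : ∀ t ≤ s, θ k t = 1 := fun t ht => hθ1 k t (by linarith)
  have key := hs' k
  have e1 : (∫ x, ‖u s x‖ ^ 2 * (θ k s * ζ s x)) = ∫ x, ‖u s x‖ ^ 2 * ζ s x := by
    simp only [h1 s le_rfl, one_mul]
  have e2 : ∫ z in {z : ℝ × E | z.1 < s},
        frobeniusNormSq (G z.1 z.2) * (θ k z.1 * ζ z.1 z.2) =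
      ∫ z in {z : ℝ × E | z.1 < s}, frobeniusNormSq (G z.1 z.2) * ζ z.1 z.2 := by
    refine setIntegral_congr_fun (hmeas s) fun z hz => ?_
    simp only [h1 z.1 (le_of_lt hz), one_mul]
  have e3 : ∫ z in {z : ℝ × E | z.1 < s},
        (‖u z.1 z.2‖ ^ 2 * (timeDeriv (fun t x => θ k t * ζ t x) z.1 z.2 +
          ν * Δ ((fun t x => θ k t * ζ t x) z.1) z.2) +
        (‖u z.1 z.2‖ ^ 2 + 2 * p z.1 z.2) *
          ⟪u z.1 z.2, gradient ((fun t x => θ k t * ζ t x) z.1) z.2⟫) =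
      ∫ z in {z : ℝ × E | z.1 < s}, localEnergyRHS ν 0 u p ζ z := by
    refine setIntegral_congr_fun (hmeas s) fun z hz => ?_
    have hz1 : z.1 < s := hz
    have h := localEnergyRHS_mul_of_hasDerivAt (ν := ν) (f := 0) (u := u) (p := p) hζ (hθd k)
      z.1 z.2
    rw [h1 z.1 hz1.le, hρ0 k z.1 (by linarith), one_mul, zero_mul, add_zero] at h
    have h' : localEnergyRHS ν 0 u p (fun t x => θ k t * ζ t x) z =
        ‖u z.1 z.2‖ ^ 2 * (timeDeriv (fun t x => θ k t * ζ t x) z.1 z.2 +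
          ν * Δ ((fun t x => θ k t * ζ t x) z.1) z.2) +
        (‖u z.1 z.2‖ ^ 2 + 2 * p z.1 z.2) *
          ⟪u z.1 z.2, gradient ((fun t x => θ k t * ζ t x) z.1) z.2⟫ := by
      simp only [localEnergyRHS, Pi.zero_apply, inner_zero_left, zero_mul, mul_zero, add_zero]
    rw [← h', h]
  -- the datum term of `θ_k ζ` is at most that of `ζ`, and vanishes when `T ≤ 0`
  have e4 : (∫ x, ‖u₀ x‖ ^ 2 * (θ k 0 * ζ 0 x)) ≤
      (if 0 < T then (∫ x, ‖u₀ x‖ ^ 2 * ζ 0 x) else 0) := by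
    have e : (∫ x, ‖u₀ x‖ ^ 2 * (θ k 0 * ζ 0 x)) = θ k 0 * ∫ x, ‖u₀ x‖ ^ 2 * ζ 0 x := by
      rw [← integral_const_mul]
      exact integral_congr_ae (Eventually.of_forall fun x => by ring)
    rw [e]
    split_ifs with hT
    · calc θ k 0 * ∫ x, ‖u₀ x‖ ^ 2 * ζ 0 x ≤ 1 * ∫ x, ‖u₀ x‖ ^ 2 * ζ 0 x :=
            mul_le_mul_of_nonneg_right (hθle k 0) hD0
        _ = _ := one_mul _
    · rw [hθ0 k 0 (by linarith [hδ0 k]), zero_mul]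
  rw [e1, e2, e3] at key
  linarith

end SliceDatum

/-! ### The ring sums in the scale-invariant normalisation -/

section RingSums

variable {z₀ z : ℝ × EuclideanSpace ℝ (Fin 3)}
  {u : ℝ → EuclideanSpace ℝ (Fin 3) → EuclideanSpace ℝ (Fin 3)}
  {p : ℝ → EuclideanSpace ℝ (Fin 3) → ℝ}

/-- `(r_j²)⁻¹ = 4^j`. [folklore] -/
theorem inv_rad_sq (j : ℕ) : ((rad j) ^ 2)⁻¹ = (4 : ℝ) ^ j := by
  have h : (rad j) ^ 2 = (1 / 4 : ℝ) ^ j := by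
    rw [rad, ← pow_mul, mul_comm, pow_mul]; norm_num
  rw [h, ← inv_pow]; norm_num

/-- `Σ_{1 ≤ j ≤ n} (r_j²)⁻¹ ≤ (1/3) (r_{n+1}²)⁻¹` (`Σ_{j=1}^{n} 4^j = (4^{n+1} - 4)/3`). [folklore] -/
theorem sum_Icc_inv_rad_sq_le (n : ℕ) :
    ∑ j ∈ Finset.Icc 1 n, ((rad j) ^ 2)⁻¹ ≤ 1 / 3 * ((rad (n + 1)) ^ 2)⁻¹ := by
  simp_rw [inv_rad_sq]
  have h : ∀ m : ℕ, 3 * ∑ j ∈ Finset.Icc 1 m, (4 : ℝ) ^ j + 4 = 4 ^ (m + 1) := by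
    intro m
    induction m with
    | zero => simp
    | succ m ih =>
        rw [Finset.sum_Icc_succ_top (by omega), mul_add, show (4 : ℝ) ^ (m + 1 + 1) =
          4 ^ (m + 1) + 3 * 4 ^ (m + 1) by ring, ← ih]
        ring
  have hm := h n
  have h4 : (0 : ℝ) ≤ 4 := by norm_num
  nlinarith [hm]

/-- From `(A'_k)`: `∫∫_{Q_{r_k}(z)} |u|³ ≤ ε₀^{2/3} r_k²`. [folklore] -/
theorem lintegral_cube_le_of_hypA' {ε₀ : ℝ} {k : ℕ}
    (h : cknC (rad k) z u + cknDOsc (rad k) z p ≤ ENNReal.ofReal (ε₀ ^ (2 / 3 : ℝ))) :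
    ∫⁻ w in parabolicCylinder (rad k) z, ‖u w.1 w.2‖ₑ ^ (3 : ℕ) ≤
      ENNReal.ofReal (ε₀ ^ (2 / 3 : ℝ) * rad k ^ 2) := by
  rw [lintegral_cube_eq_mul_cknC (rad_pos k)]
  calc ENNReal.ofReal (rad k) ^ 2 * cknC (rad k) z u
      ≤ ENNReal.ofReal (rad k) ^ 2 * ENNReal.ofReal (ε₀ ^ (2 / 3 : ℝ)) := by
        gcongr; exact le_self_add.trans h
    _ = ENNReal.ofReal (ε₀ ^ (2 / 3 : ℝ) * rad k ^ 2) := by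
        rw [← ENNReal.ofReal_pow (rad_pos k).le, ← ENNReal.ofReal_mul (by positivity), mul_comm]

/-- From `(A'_k)`: `∫∫_{Q_{r_k}(z)} |p - (p)_{r_k}|^{3/2} ≤ ε₀^{2/3} r_k²`. [folklore] -/
theorem lintegral_presOsc_le_of_hypA' {ε₀ : ℝ} {k : ℕ}
    (h : cknC (rad k) z u + cknDOsc (rad k) z p ≤ ENNReal.ofReal (ε₀ ^ (2 / 3 : ℝ))) :
    ∫⁻ w in parabolicCylinder (rad k) z, ‖p w.1 w.2 - ⨍ y in ball z.2 (rad k), p w.1 y‖ₑ ^ (3 / 2 : ℝ) ≤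
      ENNReal.ofReal (ε₀ ^ (2 / 3 : ℝ) * rad k ^ 2) := by
  have hr := rad_pos k
  have h0 : ENNReal.ofReal (rad k) ^ 2 ≠ 0 := pow_ne_zero _ (ENNReal.ofReal_pos.2 hr).ne'
  have htop : ENNReal.ofReal (rad k) ^ 2 ≠ ∞ := ENNReal.pow_ne_top ENNReal.ofReal_ne_top
  have hLD : ∫⁻ w in parabolicCylinder (rad k) z,
      ‖p w.1 w.2 - ⨍ y in ball z.2 (rad k), p w.1 y‖ₑ ^ (3 / 2 : ℝ) =
      ENNReal.ofReal (rad k) ^ 2 * cknDOsc (rad k) z p := by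
    rw [cknDOsc, ← mul_assoc, ENNReal.mul_inv_cancel h0 htop, one_mul]
  rw [hLD]
  calc ENNReal.ofReal (rad k) ^ 2 * cknDOsc (rad k) z p
      ≤ ENNReal.ofReal (rad k) ^ 2 * ENNReal.ofReal (ε₀ ^ (2 / 3 : ℝ)) := by
        gcongr; exact le_add_self.trans h
    _ = ENNReal.ofReal (ε₀ ^ (2 / 3 : ℝ) * rad k ^ 2) := by
        rw [← ENNReal.ofReal_pow hr.le, ← ENNReal.ofReal_mul (by positivity), mul_comm]

/-- **The pressure on one cylinder** (Hölder with `(A'_k)`):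
`∫∫_{Q_{r_k}(z)} |u| |p - (p)_{r_k}| ≤ (ε₀^{2/3} r_k²)^{1/3} (ε₀^{2/3} r_k²)^{2/3} = ε₀^{2/3} r_k²`. [folklore] -/
theorem lintegral_vel_presOsc_le' {ε₀ : ℝ} {k : ℕ}
    (hu : AEMeasurable (fun w : ℝ × EuclideanSpace ℝ (Fin 3) => ‖u w.1 w.2‖ₑ)
      (volume.restrict (parabolicCylinder (rad k) z)))
    (hp : AEMeasurable (fun w : ℝ × EuclideanSpace ℝ (Fin 3) =>
      ‖p w.1 w.2 - ⨍ y in ball z.2 (rad k), p w.1 y‖ₑ) (volume.restrict (parabolicCylinder (rad k) z)))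
    (hA : cknC (rad k) z u + cknDOsc (rad k) z p ≤ ENNReal.ofReal (ε₀ ^ (2 / 3 : ℝ))) :
    ∫⁻ w in parabolicCylinder (rad k) z, ‖u w.1 w.2‖ₑ * ‖p w.1 w.2 - ⨍ y in ball z.2 (rad k), p w.1 y‖ₑ ≤
      ENNReal.ofReal (ε₀ ^ (2 / 3 : ℝ) * (rad k) ^ 2) := by
  have H1 := lintegral_mul_le_L3_L32 (volume.restrict (parabolicCylinder (rad k) z)) hu hp
  set X : ℝ≥0∞ := ENNReal.ofReal (ε₀ ^ (2 / 3 : ℝ) * (rad k) ^ 2) with hX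
  have H5 : (∫⁻ w in parabolicCylinder (rad k) z, ‖u w.1 w.2‖ₑ ^ (3 : ℕ)) ^ (1 / 3 : ℝ) ≤
      X ^ (1 / 3 : ℝ) := by
    gcongr; exact lintegral_cube_le_of_hypA' hA
  have H6 : (∫⁻ w in parabolicCylinder (rad k) z,
      ‖p w.1 w.2 - ⨍ y in ball z.2 (rad k), p w.1 y‖ₑ ^ (3 / 2 : ℝ)) ^ (2 / 3 : ℝ) ≤ X ^ (2 / 3 : ℝ) := by
    gcongr; exact lintegral_presOsc_le_of_hypA' hA
  calc ∫⁻ w in parabolicCylinder (rad k) z, ‖u w.1 w.2‖ₑ * ‖p w.1 w.2 - ⨍ y in ball z.2 (rad k), p w.1 y‖ₑ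
      ≤ _ := H1
    _ ≤ X ^ (1 / 3 : ℝ) * X ^ (2 / 3 : ℝ) := mul_le_mul' H5 H6
    _ = X := by
        rw [← ENNReal.rpow_add_of_nonneg _ _ (by norm_num) (by norm_num)]
        norm_num

/-- **The cubic term over the rings** in the scale-invariant normalisation: with
`|∇φ| ≤ C₁ r² r_{j+1}⁻⁴` on the ring `Q_{r_j} ∖ Q_{r_{j+1}}` (`1 ≤ j ≤ n`), `|∇φ| ≤ C₁ r⁻²` on `Q_r`,
`r = r_{n+1}`, and `(A'_k)` for `1 ≤ k ≤ n`:
`∫∫_{Q_{1/2}} |u|³ |∇φ| ≤ Σ_j 16 C₁ ε₀^{2/3} r² r_j⁻² + 4 C₁ ε₀^{2/3} ≤ 10 C₁ ε₀^{2/3}`. [cite: RobinsonRodrigoSadowski2016, (15.16) p. 219] -/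
theorem lintegral_cube_grad_le' {ε₀ C₁ : ℝ} (hε : 0 ≤ ε₀) (hC : 0 ≤ C₁) {n : ℕ} (hn : 1 ≤ n)
    {φ : ℝ → EuclideanSpace ℝ (Fin 3) → ℝ}
    (hA : ∀ k : ℕ, 1 ≤ k → k ≤ n →
      cknC (rad k) z u + cknDOsc (rad k) z p ≤ ENNReal.ofReal (ε₀ ^ (2 / 3 : ℝ)))
    (hring : ∀ j : ℕ, 1 ≤ j → j + 1 ≤ n + 1 →
      ∀ w ∈ parabolicCylinder (rad j) z \ parabolicCylinder (rad (j + 1)) z,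
        ‖gradient (φ w.1) w.2‖ ≤ C₁ * (rad (n + 1)) ^ 2 * ((rad (j + 1)) ^ 4)⁻¹)
    (hcore : ∀ w ∈ parabolicCylinder (rad (n + 1)) z,
      ‖gradient (φ w.1) w.2‖ ≤ C₁ * ((rad (n + 1)) ^ 2)⁻¹) :
    ∫⁻ w in parabolicCylinder (rad 1) z, ‖u w.1 w.2‖ₑ ^ (3 : ℕ) * ENNReal.ofReal ‖gradient (φ w.1) w.2‖ ≤
      ENNReal.ofReal (10 * C₁ * ε₀ ^ (2 / 3 : ℝ)) := by
  set r := rad (n + 1) with hr_def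
  have hr : 0 < r := rad_pos _
  have hrn : rad n = 2 * r := by rw [hr_def, rad_succ]; ring
  have H := lintegral_mul_weight_le_sum_rings z (n := n)
    (g := fun w => ‖u w.1 w.2‖ₑ ^ (3 : ℕ)) (W := fun w => ENNReal.ofReal ‖gradient (φ w.1) w.2‖)
    (a := fun j => C₁ * r ^ 2 * ((rad (j + 1)) ^ 4)⁻¹) (b := fun j => ENNReal.ofReal (ε₀ ^ (2 / 3 : ℝ) * rad j ^ 2))
    (ac := C₁ * (r ^ 2)⁻¹) (bc := ENNReal.ofReal (ε₀ ^ (2 / 3 : ℝ) * rad n ^ 2))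
    (fun j hj w hw => ENNReal.ofReal_le_ofReal
      (hring j (Finset.mem_Icc.1 hj).1 (by linarith [(Finset.mem_Icc.1 hj).2]) w hw))
    (fun w hw => ENNReal.ofReal_le_ofReal (hcore w hw))
    (fun j hj => lintegral_cube_le_of_hypA' (hA j (Finset.mem_Icc.1 hj).1 (Finset.mem_Icc.1 hj).2))
    ((lintegral_mono_set (parabolicCylinder_mono (rad_pos _).le (rad_succ_le n) z)).trans
      (lintegral_cube_le_of_hypA' (hA n hn le_rfl)))
  refine H.trans ?_
  -- evaluate the sum
  have hsum : ∑ j ∈ Finset.Icc 1 n, ENNReal.ofReal (C₁ * r ^ 2 * ((rad (j + 1)) ^ 4)⁻¹) *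
      ENNReal.ofReal (ε₀ ^ (2 / 3 : ℝ) * rad j ^ 2) =
      ENNReal.ofReal (16 * C₁ * r ^ 2 * ε₀ ^ (2 / 3 : ℝ) * ∑ j ∈ Finset.Icc 1 n, ((rad j) ^ 2)⁻¹) := by
    rw [Finset.mul_sum, ENNReal.ofReal_sum_of_nonneg (fun j _ => by
      have := rad_pos j; positivity)]
    refine Finset.sum_congr rfl fun j _ => ?_
    have hj := rad_pos j
    have hj1 := rad_pos (j + 1)
    rw [← ENNReal.ofReal_mul (by positivity)]
    congr 1
    rw [rad_succ]
    field_simp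
    ring
  have hcore' : ENNReal.ofReal (C₁ * (r ^ 2)⁻¹) * ENNReal.ofReal (ε₀ ^ (2 / 3 : ℝ) * rad n ^ 2) =
      ENNReal.ofReal (4 * C₁ * ε₀ ^ (2 / 3 : ℝ)) := by
    rw [← ENNReal.ofReal_mul (by positivity), hrn]
    congr 1
    field_simp
    ring
  have hs0 : 0 ≤ ∑ j ∈ Finset.Icc 1 n, ((rad j) ^ 2)⁻¹ :=
    Finset.sum_nonneg fun j _ => by have := rad_pos j; positivity
  rw [hsum, hcore', ← ENNReal.ofReal_add (by positivity) (by positivity)]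
  refine ENNReal.ofReal_le_ofReal ?_
  have h1 := sum_Icc_inv_rad_sq_le n
  rw [← hr_def] at h1
  have hε23 : 0 ≤ ε₀ ^ (2 / 3 : ℝ) := Real.rpow_nonneg hε _
  have hkey : 16 * C₁ * r ^ 2 * ε₀ ^ (2 / 3 : ℝ) * ∑ j ∈ Finset.Icc 1 n, ((rad j) ^ 2)⁻¹ ≤
      16 / 3 * C₁ * ε₀ ^ (2 / 3 : ℝ) := by
    calc 16 * C₁ * r ^ 2 * ε₀ ^ (2 / 3 : ℝ) * ∑ j ∈ Finset.Icc 1 n, ((rad j) ^ 2)⁻¹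
        ≤ 16 * C₁ * r ^ 2 * ε₀ ^ (2 / 3 : ℝ) * (1 / 3 * (r ^ 2)⁻¹) := by gcongr
      _ = 16 / 3 * C₁ * ε₀ ^ (2 / 3 : ℝ) := by field_simp
  nlinarith [mul_nonneg hC hε23]

/-- **The pressure term against one `Φ_k`, from a bound on `∫∫_{Q_{r_k}} |u| |p - (p)_{r_k}|`**
(the accepted `pressure_presTest_bound` with the hypothesis `(A_k)` replaced by its consequence
`∫∫_{Q_{r_k}(z)} |u| |p - (p)_{r_k}| ≤ L`): for `t < s`, if `∇Φ_k(τ, ·)` vanishes off `Q_{r_k}(z)` and is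
bounded by `B` below the top time, and `u` is slice-wise divergence free against `Φ_k`, then
`|∫∫_{τ<t} p ⟪u, ∇Φ_k⟫| = |∫∫_{τ<t} (p - (p)_{r_k}) ⟪u, ∇Φ_k⟫| ≤ B L`, and the integrand is integrable. [cite: RobinsonRodrigoSadowski2016, p. 223] -/
theorem pressure_presTest_bound_of_le {Ω : Set (ℝ × EuclideanSpace ℝ (Fin 3))} {n : ℕ}
    {φ : ℝ → EuclideanSpace ℝ (Fin 3) → ℝ}
    (hu_meas : AEStronglyMeasurable (uncurry u) (volume.restrict Ω))
    (hp_meas : AEStronglyMeasurable (uncurry p) (volume.restrict Ω))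
    (hu3 : ∫⁻ w in Ω, ‖u w.1 w.2‖ₑ ^ (3 : ℕ) ≠ ∞)
    (hp32 : ∫⁻ w in Ω, ‖p w.1 w.2‖ₑ ^ (3 / 2 : ℝ) ≠ ∞)
    {k : ℕ} (hsubk : parabolicCylinder (rad k) z ⊆ Ω)
    (hdivk : ∀ᵐ τ ∂(volume : Measure ℝ), τ < z.1 →
      ∫ y, ⟪u τ y, gradient (presTest z n φ k τ) y⟫ = 0)
    (hgradc : Continuous (fun w : ℝ × EuclideanSpace ℝ (Fin 3) => gradient (presTest z n φ k w.1) w.2))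
    (hgrad0 : ∀ τ < z.1, ∀ y, (τ, y) ∉ parabolicCylinder (rad k) z →
      gradient (presTest z n φ k τ) y = 0)
    {B : ℝ} (hB : 0 ≤ B) (hgradb : ∀ τ < z.1, ∀ y, ‖gradient (presTest z n φ k τ) y‖ ≤ B)
    {L : ℝ} (hL0 : 0 ≤ L)
    (hL : ∫⁻ w in parabolicCylinder (rad k) z,
      ‖u w.1 w.2‖ₑ * ‖p w.1 w.2 - ⨍ y in ball z.2 (rad k), p w.1 y‖ₑ ≤ ENNReal.ofReal L)
    {t : ℝ} (ht : t < z.1) :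
    IntegrableOn (fun w : ℝ × EuclideanSpace ℝ (Fin 3) =>
        p w.1 w.2 * ⟪u w.1 w.2, gradient (presTest z n φ k w.1) w.2⟫) {w | w.1 < t} volume ∧
      |∫ w in {w : ℝ × EuclideanSpace ℝ (Fin 3) | w.1 < t},
          p w.1 w.2 * ⟪u w.1 w.2, gradient (presTest z n φ k w.1) w.2⟫| ≤ B * L := by
  set S : Set (ℝ × EuclideanSpace ℝ (Fin 3)) := {w | w.1 < t} with hS_def
  set Qk := parabolicCylinder (rad k) z with hQk_def
  have hSm : MeasurableSet S := measurableSet_lt measurable_fst measurable_const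
  have hQm : MeasurableSet Qk := (isOpen_parabolicCylinder _ z).measurableSet
  set pbar : ℝ × EuclideanSpace ℝ (Fin 3) → ℝ := fun w => ⨍ y in ball z.2 (rad k), p w.1 y with hpbar
  set Ip : ℝ × EuclideanSpace ℝ (Fin 3) → ℝ := fun w =>
    ⟪u w.1 w.2, gradient (presTest z n φ k w.1) w.2⟫ with hIp
  -- measurability on `Qk`
  have hμk := Measure.restrict_mono (μ := volume) (ν := volume) hsubk le_rfl
  have hu_k : AEStronglyMeasurable (uncurry u) (volume.restrict Qk) := hu_meas.mono_measure hμk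
  have hp_k : AEStronglyMeasurable (uncurry p) (volume.restrict Qk) := hp_meas.mono_measure hμk
  have hpbar_k : AEStronglyMeasurable pbar (volume.restrict Qk) := aestronglyMeasurable_setAverage_fst hp_k
  have hIp_k : AEStronglyMeasurable Ip (volume.restrict Qk) :=
    hu_k.inner hgradc.aestronglyMeasurable
  -- pointwise bound `‖Ip‖ ≤ ‖u‖ B` on `Qk` (all its points are below the top time)
  have hQk_lt : ∀ w ∈ Qk, w.1 < z.1 := fun w hw => ((mem_parabolicCylinder.1 hw).1).2
  have hIp_le : ∀ w : ℝ × EuclideanSpace ℝ (Fin 3), w.1 < z.1 → ‖Ip w‖ ≤ ‖u w.1 w.2‖ * B := fun w hw =>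
    (norm_inner_le_norm _ _).trans (mul_le_mul_of_nonneg_left (hgradb w.1 hw w.2) (norm_nonneg _))
  -- `∫_{Qk} ‖Ip‖ₑ³ < ∞`
  have hIp3 : ∫⁻ w in Qk, ‖Ip w‖ₑ ^ (3 : ℕ) ≠ ∞ := by
    refine ne_of_lt ?_
    calc ∫⁻ w in Qk, ‖Ip w‖ₑ ^ (3 : ℕ)
        ≤ ∫⁻ w in Qk, (‖u w.1 w.2‖ₑ * ENNReal.ofReal B) ^ (3 : ℕ) := by
          refine setLIntegral_mono' hQm fun w hw => ?_
          gcongr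
          calc ‖Ip w‖ₑ = ENNReal.ofReal ‖Ip w‖ := (ofReal_norm _).symm
            _ ≤ ENNReal.ofReal (‖u w.1 w.2‖ * B) := ENNReal.ofReal_le_ofReal (hIp_le w (hQk_lt w hw))
            _ = _ := by rw [ENNReal.ofReal_mul (norm_nonneg _), ofReal_norm]
      _ = ENNReal.ofReal B ^ (3 : ℕ) * ∫⁻ w in Qk, ‖u w.1 w.2‖ₑ ^ (3 : ℕ) := by
          rw [← lintegral_const_mul' _ _ (ENNReal.pow_ne_top ENNReal.ofReal_ne_top)]
          exact lintegral_congr fun w => by ring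
      _ < ∞ := ENNReal.mul_lt_top (ENNReal.pow_lt_top ENNReal.ofReal_lt_top)
          (((lintegral_mono_set hsubk).trans_lt (lt_top_iff_ne_top.2 hu3)))
  -- integrability of `P = Ip * p` and `M = Ip * pbar` on `Qk`
  have hP_k : IntegrableOn (fun w => Ip w * p w.1 w.2) Qk volume :=
    integrableOn_mul_of_L3_L32 hIp_k hp_k hIp3
      (ne_of_lt ((lintegral_mono_set hsubk).trans_lt (lt_top_iff_ne_top.2 hp32)))
  have hM_k : IntegrableOn (fun w => Ip w * pbar w) Qk volume := by
    refine integrableOn_mul_of_L3_L32 hIp_k hpbar_k hIp3 (ne_of_lt ?_)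
    calc ∫⁻ w in Qk, ‖pbar w‖ₑ ^ (3 / 2 : ℝ) ≤ ∫⁻ w in Qk, ‖p w.1 w.2‖ₑ ^ (3 / 2 : ℝ) :=
          lintegral_cylinder_enorm_average_rpow_le (rad_pos k) z hp_k (by norm_num)
      _ < ∞ := (lintegral_mono_set hsubk).trans_lt (lt_top_iff_ne_top.2 hp32)
  -- extension by zero to `S`
  have hzero : ∀ w ∈ S \ Qk, Ip w = 0 := fun w hw => by
    have hw1 : w.1 < z.1 := lt_trans hw.1 ht
    simp only [hIp]
    rw [hgrad0 w.1 hw1 w.2 hw.2, inner_zero_right]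
  have hP_S : IntegrableOn (fun w => Ip w * p w.1 w.2) S volume :=
    hP_k.of_forall_sdiff_eq_zero hSm fun w hw => by rw [hzero w hw, zero_mul]
  have hM_S : IntegrableOn (fun w => Ip w * pbar w) S volume :=
    hM_k.of_forall_sdiff_eq_zero hSm fun w hw => by rw [hzero w hw, zero_mul]
  -- the mean term integrates to zero (Fubini and slice-wise divergence freedom)
  have hM0 : ∫ w in S, Ip w * pbar w = 0 := by
    rw [← integral_indicator hSm]
    have hI : Integrable (S.indicator fun w => Ip w * pbar w) (volume : Measure (ℝ × EuclideanSpace ℝ (Fin 3))) :=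
      (integrable_indicator_iff hSm).2 hM_S
    rw [Measure.volume_eq_prod] at hI ⊢
    rw [integral_prod _ hI]
    refine integral_eq_zero_of_ae ?_
    filter_upwards [hdivk] with τ hτ
    by_cases hτt : τ < t
    · have e : (fun y => S.indicator (fun w => Ip w * pbar w) (τ, y)) =
          fun y => (⨍ y' in ball z.2 (rad k), p τ y') * ⟪u τ y, gradient (presTest z n φ k τ) y⟫ := by
        funext y
        rw [indicator_of_mem (show (τ, y) ∈ S from hτt)]
        simp only [hIp, hpbar]
        ring
      simp only [e]
      rw [Pi.zero_apply, integral_const_mul, hτ (lt_trans hτt ht), mul_zero]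
    · have e : (fun y => S.indicator (fun w => Ip w * pbar w) (τ, y)) = fun _ => 0 := by
        funext y
        exact indicator_of_notMem (show (τ, y) ∉ S from hτt) _
      simp only [e]
      rw [Pi.zero_apply]
      exact integral_zero _ _
  -- the bound
  refine ⟨hP_S.congr_fun (fun w _ => mul_comm _ _) hSm, ?_⟩
  have hsplit : ∫ w in S, p w.1 w.2 * Ip w = ∫ w in S, (p w.1 w.2 - pbar w) * Ip w := by
    have e1 : ∫ w in S, p w.1 w.2 * Ip w = ∫ w in S, Ip w * p w.1 w.2 :=
      integral_congr_ae (Eventually.of_forall fun w => mul_comm _ _)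
    have e2 : ∫ w in S, (p w.1 w.2 - pbar w) * Ip w =
        ∫ w in S, (Ip w * p w.1 w.2 - Ip w * pbar w) :=
      integral_congr_ae (Eventually.of_forall fun w => by ring)
    rw [e1, e2, integral_sub hP_S hM_S, hM0, sub_zero]
  rw [show (fun w : ℝ × EuclideanSpace ℝ (Fin 3) =>
      p w.1 w.2 * ⟪u w.1 w.2, gradient (presTest z n φ k w.1) w.2⟫) = fun w => p w.1 w.2 * Ip w from rfl,
    hsplit]
  have hfinG : ∫⁻ w in Qk, ENNReal.ofReal B * (‖u w.1 w.2‖ₑ * ‖p w.1 w.2 - pbar w‖ₑ) ≠ ∞ := by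
    rw [lintegral_const_mul' _ _ ENNReal.ofReal_ne_top]
    exact ENNReal.mul_ne_top ENNReal.ofReal_ne_top (ne_top_of_le_ne_top ENNReal.ofReal_ne_top hL)
  have hnorm := norm_setIntegral_le_toReal_lintegral (μ := volume) hSm hQm
    (g := fun w => (p w.1 w.2 - pbar w) * Ip w)
    (G := fun w => ENNReal.ofReal B * (‖u w.1 w.2‖ₑ * ‖p w.1 w.2 - pbar w‖ₑ)) (fun w hw => ?_) hfinG
  · rw [Real.norm_eq_abs] at hnorm
    refine hnorm.trans ?_
    rw [lintegral_const_mul' _ _ ENNReal.ofReal_ne_top, ENNReal.toReal_mul, ENNReal.toReal_ofReal hB]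
    exact mul_le_mul_of_nonneg_left (ENNReal.toReal_le_of_le_ofReal hL0 hL) hB
  · -- the pointwise domination on `S`
    by_cases hwQ : w ∈ Qk
    · rw [indicator_of_mem hwQ]
      calc ‖(p w.1 w.2 - pbar w) * Ip w‖ₑ = ENNReal.ofReal ‖(p w.1 w.2 - pbar w) * Ip w‖ :=
            (ofReal_norm _).symm
        _ ≤ ENNReal.ofReal (‖p w.1 w.2 - pbar w‖ * (‖u w.1 w.2‖ * B)) := by
            refine ENNReal.ofReal_le_ofReal ?_
            rw [norm_mul]
            exact mul_le_mul_of_nonneg_left (hIp_le w (hQk_lt w hwQ)) (norm_nonneg _)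
        _ = ENNReal.ofReal B * (‖u w.1 w.2‖ₑ * ‖p w.1 w.2 - pbar w‖ₑ) := by
            rw [ENNReal.ofReal_mul (norm_nonneg _), ENNReal.ofReal_mul (norm_nonneg _), ofReal_norm,
              ofReal_norm]
            ring
    · rw [indicator_of_notMem hwQ, hzero w ⟨hw, hwQ⟩, mul_zero, enorm_zero]

/-- **Slice-wise divergence freedom against `Φ_k`**, from `div u = 0` in `𝒟'(Q_1(z₀))` and the
local integrability of `u` (the accepted `ae_integral_inner_gradient_presTest_eq_zero` without the
suitable-pair structure): for `z ∈ Q_{1/2}(z₀)` and a.e. `τ < s`, `∫ ⟪u(τ), ∇Φ_k(τ, ·)⟫ = 0`. [cite: RobinsonRodrigoSadowski2016, (15.24) p. 222] -/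
theorem ae_integral_inner_gradient_presTest_eq_zero' {n : ℕ} {φ : ℝ → EuclideanSpace ℝ (Fin 3) → ℝ}
    (hu : LocallyIntegrableOn (uncurry u) (parabolicCylinder 1 z₀) volume)
    (hdiv : ∀ θ : ℝ → EuclideanSpace ℝ (Fin 3) → ℝ, IsSpaceTimeTestOn (parabolicCylinderOpens 1 z₀) θ →
      ∫ w in parabolicCylinder 1 z₀, ⟪u w.1 w.2, gradient (θ w.1) w.2⟫ = 0)
    (hz : z ∈ parabolicCylinder (1 / 2) z₀) (hφs : ContDiff ℝ (⊤ : ℕ∞) (uncurry φ))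
    (hφc : HasCompactSupport (uncurry φ)) {ρ : ℝ}
    (hbox : support (uncurry φ) ⊆ Ioo (z.1 - 1 / 9) (z.1 + ρ) ×ˢ ball z.2 (1 / 2))
    (h13 : support (uncurry φ) ∩ parabolicCylinder 1 z ⊆ parabolicCylinder (1 / 3) z) (k : ℕ) :
    ∀ᵐ τ ∂(volume : Measure ℝ), τ < z.1 →
      ∫ y, ⟪u τ y, gradient (presTest z n φ k τ) y⟫ = 0 := by
  set δ : ℕ → ℝ := fun j => 1 / ((j : ℝ) + 1) with hδ
  have hδ0 : ∀ j, 0 < δ j := fun j => by positivity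
  choose θ ρ' hθs hθd hθ1 hθ0 hρ0 hθnn using fun j => exists_time_level_cutoff z.1 (hδ0 j)
  have hPT := isSpaceTimeTestOn_top_presTest (z := z) (n := n) hφs hφc k
  have hζQ : ∀ τ' < z.1, tsupport (uncurry (presTest z n φ k)) ∩ {w | w.1 ≤ τ'} ⊆
      ((parabolicCylinderOpens 1 z₀ : Opens (ℝ × EuclideanSpace ℝ (Fin 3))) :
        Set (ℝ × EuclideanSpace ℝ (Fin 3))) := fun τ' hτ' =>
    (inter_subset_inter_left _ (tsupport_presTest_subset φ k)).trans
      (tsupport_inter_subset_of_box hz hbox h13 τ' hτ')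
  have htest : ∀ j, IsSpaceTimeTestOn (parabolicCylinderOpens 1 z₀)
      (fun t x => θ j t * presTest z n φ k t x) := fun j =>
    hPT.time_mul_of_forall_lt hζQ (hθs j) (by linarith [hδ0 j]) (hθ0 j)
  have hu' : LocallyIntegrableOn (uncurry u)
      ((parabolicCylinderOpens 1 z₀ : Opens (ℝ × EuclideanSpace ℝ (Fin 3))) :
        Set (ℝ × EuclideanSpace ℝ (Fin 3))) volume := hu
  have hae := ae_all_iff.2 fun j =>
    ae_integral_inner_gradient_eq_zero hu' hdiv (htest j)
  filter_upwards [hae] with τ hτ' hτs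
  obtain ⟨j, hj⟩ := exists_nat_one_div_lt (show 0 < (z.1 - τ) / 3 by linarith)
  have hj' : τ < z.1 - 3 * δ j := by
    simp only [hδ]
    linarith
  have h1 : θ j τ = 1 := hθ1 j τ hj'.le
  have e : (fun x => θ j τ * presTest z n φ k τ x) = presTest z n φ k τ := by
    funext x; rw [h1, one_mul]
  have := hτ' j
  rw [e] at this
  exact this

end RingSums

/-! ### The bounds below a time level -/

section Bounds

variable {z₀ z : ℝ × EuclideanSpace ℝ (Fin 3)} {n : ℕ}
  {u : ℝ → EuclideanSpace ℝ (Fin 3) → EuclideanSpace ℝ (Fin 3)}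
  {p : ℝ → EuclideanSpace ℝ (Fin 3) → ℝ}
  {G : ℝ → EuclideanSpace ℝ (Fin 3) → EuclideanSpace ℝ (Fin 3) →L[ℝ] EuclideanSpace ℝ (Fin 3)}
  {φ : ℝ → EuclideanSpace ℝ (Fin 3) → ℝ}

/-- **The cubic term `I₂`** in the scale-invariant normalisation: for `t ≤ s`,
`|∫∫_{τ<t} |u|² u·∇φ| ≤ ∫∫_{Q_{1/2}} |u|³ |∇φ| ≤ 10 C₁ ε₀^{2/3}`. [cite: RobinsonRodrigoSadowski2016, (15.16) p. 219] -/
theorem abs_setIntegral_cubic_le' (hn : 1 ≤ n) {ε₀ C₁ : ℝ} (hε : 0 ≤ ε₀) (hC : 0 ≤ C₁)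
    (hA : ∀ k : ℕ, 1 ≤ k → k ≤ n →
      cknC (rad k) z u + cknDOsc (rad k) z p ≤ ENNReal.ofReal (ε₀ ^ (2 / 3 : ℝ)))
    (hφ : IsSpaceTimeTestOn (⊤ : Opens (ℝ × EuclideanSpace ℝ (Fin 3))) φ) {ρ : ℝ}
    (hbox : support (uncurry φ) ⊆ Ioo (z.1 - 1 / 9) (z.1 + ρ) ×ˢ ball z.2 (1 / 2))
    (h13 : support (uncurry φ) ∩ parabolicCylinder 1 z ⊆ parabolicCylinder (1 / 3) z)
    (hring : ∀ j : ℕ, 1 ≤ j → j + 1 ≤ n + 1 →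
      ∀ w ∈ parabolicCylinder (rad j) z \ parabolicCylinder (rad (j + 1)) z,
        ‖gradient (φ w.1) w.2‖ ≤ C₁ * (rad (n + 1)) ^ 2 * ((rad (j + 1)) ^ 4)⁻¹)
    (hcore : ∀ w ∈ parabolicCylinder (rad (n + 1)) z,
      ‖gradient (φ w.1) w.2‖ ≤ C₁ * ((rad (n + 1)) ^ 2)⁻¹)
    {t : ℝ} (ht : t ≤ z.1) :
    |∫ w in {w : ℝ × EuclideanSpace ℝ (Fin 3) | w.1 < t},
        ‖u w.1 w.2‖ ^ 2 * ⟪u w.1 w.2, gradient (φ w.1) w.2⟫| ≤ 10 * C₁ * ε₀ ^ (2 / 3 : ℝ) := by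
  set S : Set (ℝ × EuclideanSpace ℝ (Fin 3)) := {w | w.1 < t} with hS_def
  have hSm : MeasurableSet S := measurableSet_lt measurable_fst measurable_const
  have hQm : MeasurableSet (parabolicCylinder (rad 1) z) := (isOpen_parabolicCylinder _ z).measurableSet
  obtain ⟨-, -, hg0⟩ := hφ.continuous_gradient_field
  have hL := lintegral_cube_grad_le' (u := u) hε hC hn hA hring hcore
  have hfin : ∫⁻ w in parabolicCylinder (rad 1) z,
      ‖u w.1 w.2‖ₑ ^ (3 : ℕ) * ENNReal.ofReal ‖gradient (φ w.1) w.2‖ ≠ ∞ :=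
    ne_top_of_le_ne_top ENNReal.ofReal_ne_top hL
  have h := norm_setIntegral_le_toReal_lintegral (μ := volume) hSm hQm
    (g := fun w => ‖u w.1 w.2‖ ^ 2 * ⟪u w.1 w.2, gradient (φ w.1) w.2⟫)
    (G := fun w => ‖u w.1 w.2‖ₑ ^ (3 : ℕ) * ENNReal.ofReal ‖gradient (φ w.1) w.2‖) (fun w hw => ?_) hfin
  · rw [Real.norm_eq_abs] at h
    have h24 : 0 ≤ 10 * C₁ * ε₀ ^ (2 / 3 : ℝ) := by positivity
    exact h.trans (ENNReal.toReal_le_of_le_ofReal h24 hL)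
  · by_cases hK : w ∈ tsupport (uncurry φ)
    · have hws : w.1 < z.1 := lt_of_lt_of_le hw ht
      have hwQ : w ∈ parabolicCylinder (rad 1) z :=
        mem_parabolicCylinder_radOne_of_mem_box (mem_box_of_mem_tsupport hbox h13 hK hws) hws
      rw [indicator_of_mem hwQ]
      calc ‖‖u w.1 w.2‖ ^ 2 * ⟪u w.1 w.2, gradient (φ w.1) w.2⟫‖ₑ
          = ENNReal.ofReal (‖u w.1 w.2‖ ^ 2 * |⟪u w.1 w.2, gradient (φ w.1) w.2⟫|) := by
            rw [← ofReal_norm, norm_mul, Real.norm_of_nonneg (sq_nonneg _), Real.norm_eq_abs]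
        _ ≤ ENNReal.ofReal (‖u w.1 w.2‖ ^ 3 * ‖gradient (φ w.1) w.2‖) := by
            refine ENNReal.ofReal_le_ofReal ?_
            calc ‖u w.1 w.2‖ ^ 2 * |⟪u w.1 w.2, gradient (φ w.1) w.2⟫|
                ≤ ‖u w.1 w.2‖ ^ 2 * (‖u w.1 w.2‖ * ‖gradient (φ w.1) w.2‖) :=
                  mul_le_mul_of_nonneg_left (abs_real_inner_le_norm _ _) (sq_nonneg _)
              _ = _ := by ring
        _ = ‖u w.1 w.2‖ₑ ^ (3 : ℕ) * ENNReal.ofReal ‖gradient (φ w.1) w.2‖ := by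
            rw [ENNReal.ofReal_mul (pow_nonneg (norm_nonneg _) 3), ENNReal.ofReal_pow (norm_nonneg _),
              ofReal_norm]
    · rw [hg0 w hK, inner_zero_right, mul_zero, enorm_zero]
      exact zero_le

/-- **The pressure term `I₃`** in the scale-invariant normalisation (RRS p. 223, telescoping):
for `t < s`, with `div u = 0` in `𝒟'(Q_1(z₀))` and `(A'_k)` for `1 ≤ k ≤ n`,
`|∫∫_{τ<t} p u·∇φ| ≤ Σ_k c' C₁ r² r_k⁻⁴ · ε₀^{2/3} r_k² ≤ c' C₁ ε₀^{2/3}`, `c' = 256 + 136 c_χ`. [cite: RobinsonRodrigoSadowski2016, p. 223] -/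
theorem abs_setIntegral_pressure_le'
    (hu_li : LocallyIntegrableOn (uncurry u) (parabolicCylinder 1 z₀) volume)
    (hp : AEStronglyMeasurable (uncurry p) (volume.restrict (parabolicCylinder 1 z₀)))
    (hdiv : ∀ θ : ℝ → EuclideanSpace ℝ (Fin 3) → ℝ, IsSpaceTimeTestOn (parabolicCylinderOpens 1 z₀) θ →
      ∫ w in parabolicCylinder 1 z₀, ⟪u w.1 w.2, gradient (θ w.1) w.2⟫ = 0)
    (hn : 1 ≤ n) (hz : z ∈ parabolicCylinder (1 / 2) z₀)
    (hu3 : ∫⁻ w in parabolicCylinder 1 z₀, ‖u w.1 w.2‖ₑ ^ (3 : ℕ) ≠ ∞)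
    (hp32 : ∫⁻ w in parabolicCylinder 1 z₀, ‖p w.1 w.2‖ₑ ^ (3 / 2 : ℝ) ≠ ∞)
    {ε₀ C₁ cχ : ℝ} (hε : 0 ≤ ε₀) (hC : 0 ≤ C₁) (hcχ0 : 0 ≤ cχ)
    (hcχ : ∀ ρ : ℝ, 0 < ρ → ∀ (τ : ℝ) (y : EuclideanSpace ℝ (Fin 3)), ‖fderiv ℝ (cylCut z ρ τ) y‖ ≤ cχ / ρ)
    (hA : ∀ k : ℕ, 1 ≤ k → k ≤ n →
      cknC (rad k) z u + cknDOsc (rad k) z p ≤ ENNReal.ofReal (ε₀ ^ (2 / 3 : ℝ)))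
    (hφs : ContDiff ℝ (⊤ : ℕ∞) (uncurry φ)) (hφc : HasCompactSupport (uncurry φ)) (hφ0 : ∀ t x, 0 ≤ φ t x)
    {ρ : ℝ} (hbox : support (uncurry φ) ⊆ Ioo (z.1 - 1 / 9) (z.1 + ρ) ×ˢ ball z.2 (1 / 2))
    (h13 : support (uncurry φ) ∩ parabolicCylinder 1 z ⊆ parabolicCylinder (1 / 3) z)
    (hcore : ∀ w ∈ parabolicCylinder (rad (n + 1)) z,
      φ w.1 w.2 ≤ C₁ * (rad (n + 1))⁻¹ ∧ ‖gradient (φ w.1) w.2‖ ≤ C₁ * ((rad (n + 1)) ^ 2)⁻¹)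
    (hring : ∀ j : ℕ, 1 ≤ j → j + 1 ≤ n + 1 →
      ∀ w ∈ parabolicCylinder (rad j) z \ parabolicCylinder (rad (j + 1)) z,
        φ w.1 w.2 ≤ C₁ * (rad (n + 1)) ^ 2 * ((rad (j + 1)) ^ 3)⁻¹ ∧
          ‖gradient (φ w.1) w.2‖ ≤ C₁ * (rad (n + 1)) ^ 2 * ((rad (j + 1)) ^ 4)⁻¹)
    {t : ℝ} (ht : t < z.1) :
    |∫ w in {w : ℝ × EuclideanSpace ℝ (Fin 3) | w.1 < t}, p w.1 w.2 * ⟪u w.1 w.2, gradient (φ w.1) w.2⟫| ≤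
      (256 + 136 * cχ) * C₁ * ε₀ ^ (2 / 3 : ℝ) := by
  set S : Set (ℝ × EuclideanSpace ℝ (Fin 3)) := {w | w.1 < t} with hS_def
  have hSm : MeasurableSet S := measurableSet_lt measurable_fst measurable_const
  set Q1 := parabolicCylinder 1 z₀ with hQ1
  set r := rad (n + 1) with hr_def
  have hr : 0 < r := rad_pos _
  set c' : ℝ := 256 + 136 * cχ with hc'
  have hc'0 : 0 ≤ c' := by positivity
  have hu : AEStronglyMeasurable (uncurry u) (volume.restrict Q1) := hu_li.aestronglyMeasurable
  -- slices of `φ` differentiable; bounds in `fderiv` form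
  have hφtop : IsSpaceTimeTestOn (⊤ : Opens (ℝ × EuclideanSpace ℝ (Fin 3))) φ :=
    ⟨hφs, hφc, fun _ _ => trivial⟩
  have hφd : ∀ τ, Differentiable ℝ (φ τ) := fun τ => (hφtop.contDiff_slice τ).differentiable (by simp)
  have hcore' : ∀ w ∈ parabolicCylinder (rad (n + 1)) z,
      φ w.1 w.2 ≤ C₁ * (rad (n + 1))⁻¹ ∧ ‖fderiv ℝ (φ w.1) w.2‖ ≤ C₁ * ((rad (n + 1)) ^ 2)⁻¹ := fun w hw =>
    ⟨(hcore w hw).1, by rw [← Scheffer.norm_gradient_eq_norm_fderiv]; exact (hcore w hw).2⟩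
  have hring' : ∀ j : ℕ, 1 ≤ j → j + 1 ≤ n + 1 →
      ∀ w ∈ parabolicCylinder (rad j) z \ parabolicCylinder (rad (j + 1)) z,
        φ w.1 w.2 ≤ C₁ * (rad (n + 1)) ^ 2 * ((rad (j + 1)) ^ 3)⁻¹ ∧
          ‖fderiv ℝ (φ w.1) w.2‖ ≤ C₁ * (rad (n + 1)) ^ 2 * ((rad (j + 1)) ^ 4)⁻¹ := fun j hj hjn w hw =>
    ⟨(hring j hj hjn w hw).1, by rw [← Scheffer.norm_gradient_eq_norm_fderiv]; exact (hring j hj hjn w hw).2⟩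
  -- per-`k` data
  have hk_all : ∀ k ∈ Finset.Icc 1 n,
      IntegrableOn (fun w : ℝ × EuclideanSpace ℝ (Fin 3) =>
          p w.1 w.2 * ⟪u w.1 w.2, gradient (presTest z n φ k w.1) w.2⟫) S volume ∧
        |∫ w in S, p w.1 w.2 * ⟪u w.1 w.2, gradient (presTest z n φ k w.1) w.2⟫| ≤
          (c' * C₁ * r ^ 2 * ((rad k) ^ 4)⁻¹) * (ε₀ ^ (2 / 3 : ℝ) * (rad k) ^ 2) := by
    intro k hk
    obtain ⟨hk1, hkn⟩ := Finset.mem_Icc.1 hk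
    have hPT := isSpaceTimeTestOn_top_presTest (z := z) (n := n) hφs hφc k
    obtain ⟨hgc, -, -⟩ := hPT.continuous_gradient_field
    have hsubk : parabolicCylinder (rad k) z ⊆ Q1 := parabolicCylinder_rad_subset hz hk1
    have hμk := Measure.restrict_mono (μ := volume) (ν := volume) hsubk le_rfl
    have hu_k : AEStronglyMeasurable (uncurry u) (volume.restrict (parabolicCylinder (rad k) z)) :=
      hu.mono_measure hμk
    have hp_k : AEStronglyMeasurable (uncurry p) (volume.restrict (parabolicCylinder (rad k) z)) :=
      hp.mono_measure hμk
    have hL := lintegral_vel_presOsc_le' (z := z) (u := u) (p := p) hu_k.enorm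
      (hp_k.sub (aestronglyMeasurable_setAverage_fst hp_k)).enorm (hA k hk1 hkn)
    refine pressure_presTest_bound_of_le hu hp hu3 hp32 hsubk
      (ae_integral_inner_gradient_presTest_eq_zero' hu_li hdiv hz hφs hφc hbox h13 k) hgc
      (fun τ hτ y hw => ?_) (by have := rad_pos k; positivity) (fun τ hτ y => ?_)
      (by have := rad_pos k; positivity) hL ht
    · rw [gradient, fderiv_presTest_eq_zero_of_notMem hφ0 hτ hw, map_zero]
    · rw [Scheffer.norm_gradient_eq_norm_fderiv]
      exact norm_fderiv_presTest_le hk1 hkn hC hcχ0 hcχ hφd hφ0 hcore' hring' hτ y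
  -- decomposition of the integrand on `S`
  have hdecomp : ∀ w ∈ S, p w.1 w.2 * ⟪u w.1 w.2, gradient (φ w.1) w.2⟫ =
      ∑ k ∈ Finset.Icc 1 n, p w.1 w.2 * ⟪u w.1 w.2, gradient (presTest z n φ k w.1) w.2⟫ := by
    intro w hw
    rw [gradient_eq_sum_presTest hn hφd hbox h13 (lt_trans hw ht) w.2, inner_sum, Finset.mul_sum]
  rw [setIntegral_congr_fun hSm hdecomp, integral_finsetSum _ (fun k hk => (hk_all k hk).1)]
  calc |∑ k ∈ Finset.Icc 1 n, ∫ w in S, p w.1 w.2 * ⟪u w.1 w.2, gradient (presTest z n φ k w.1) w.2⟫|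
      ≤ ∑ k ∈ Finset.Icc 1 n, |∫ w in S, p w.1 w.2 * ⟪u w.1 w.2, gradient (presTest z n φ k w.1) w.2⟫| :=
        Finset.abs_sum_le_sum_abs _ _
    _ ≤ ∑ k ∈ Finset.Icc 1 n, (c' * C₁ * r ^ 2 * ((rad k) ^ 4)⁻¹) * (ε₀ ^ (2 / 3 : ℝ) * (rad k) ^ 2) :=
        Finset.sum_le_sum fun k hk => (hk_all k hk).2
    _ = c' * C₁ * r ^ 2 * ε₀ ^ (2 / 3 : ℝ) * ∑ k ∈ Finset.Icc 1 n, ((rad k) ^ 2)⁻¹ := by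
        rw [Finset.mul_sum]
        refine Finset.sum_congr rfl fun k _ => ?_
        have hk := rad_pos k
        field_simp
    _ ≤ c' * C₁ * r ^ 2 * ε₀ ^ (2 / 3 : ℝ) * (1 / 3 * (r ^ 2)⁻¹) := by
        gcongr
        exact sum_Icc_inv_rad_sq_le n
    _ = c' * C₁ * ε₀ ^ (2 / 3 : ℝ) * (1 / 3) := by field_simp
    _ ≤ c' * C₁ * ε₀ ^ (2 / 3 : ℝ) * 1 := by gcongr; norm_num
    _ = _ := by ring

/-- **The datum term is scale-invariantly small.** Let `z = (s, a)` with `s > 0`, `φ ≥ 0` a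
function with the support and size properties of the test functions `φ_{n+1}` of Lemma 15.11 at
`z` (`supp φ ⊆ (s - 1/9, s + ρ) × B_{1/2}(a)`, `supp φ ∩ Q_1(z) ⊆ Q_{1/3}(z)`, `φ ≤ C₁ r⁻¹` on
`Q_r(z)`, `r = r_{n+1}`, `φ ≤ C₁ r² r_{j+1}⁻³` on the rings `Q_{r_j} ∖ Q_{r_{j+1}}`, `1 ≤ j ≤ n`), and
`u₀` a datum with `∫_{B_ρ'(a)} |u₀|² ≤ N ρ'` for `0 < ρ' ≤ 1`. Then `∫ |u₀|² φ(0, ·) ≤ 4 C₁ N`: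
the slice `{t = 0}` of the ring decomposition of `Q_{1/2}(z)` — core `C₁ r⁻¹ · N r`, rings
`Σ_j C₁ r² r_{j+1}⁻³ · N r_j = 8 C₁ N r² Σ_j r_j⁻² ≤ (8/3) C₁ N`. [folklore] -/
theorem lintegral_datum_le {u₀ : EuclideanSpace ℝ (Fin 3) → EuclideanSpace ℝ (Fin 3)}
    {N C₁ : ℝ} (hN0 : 0 ≤ N) (hC : 0 ≤ C₁) (hs : 0 < z.1)
    (hN : ∀ ρ' : ℝ, 0 < ρ' → ρ' ≤ 1 → ∫⁻ x in ball z.2 ρ', ‖u₀ x‖ₑ ^ 2 ≤ ENNReal.ofReal (N * ρ'))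
    {ρ : ℝ}
    (hbox : support (uncurry φ) ⊆ Ioo (z.1 - 1 / 9) (z.1 + ρ) ×ˢ ball z.2 (1 / 2))
    (h13 : support (uncurry φ) ∩ parabolicCylinder 1 z ⊆ parabolicCylinder (1 / 3) z)
    (hcore : ∀ w ∈ parabolicCylinder (rad (n + 1)) z, φ w.1 w.2 ≤ C₁ * (rad (n + 1))⁻¹)
    (hring : ∀ j : ℕ, 1 ≤ j → j + 1 ≤ n + 1 →
      ∀ w ∈ parabolicCylinder (rad j) z \ parabolicCylinder (rad (j + 1)) z,
        φ w.1 w.2 ≤ C₁ * (rad (n + 1)) ^ 2 * ((rad (j + 1)) ^ 3)⁻¹) :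
    ∫⁻ x, ‖u₀ x‖ₑ ^ 2 * ENNReal.ofReal (φ 0 x) ≤ ENNReal.ofReal (4 * C₁ * N) := by
  classical
  set r := rad (n + 1) with hr_def
  have hr : 0 < r := rad_pos _
  -- the slice `{t = 0}` of the support of `φ` lies in `Q_{r_1}(z)`
  have hslice : ∀ x, φ 0 x ≠ 0 → ((0 : ℝ), x) ∈ parabolicCylinder (rad 1) z := by
    intro x hx
    have hmem : ((0 : ℝ), x) ∈ support (uncurry φ) := by exact hx
    have hb := hbox hmem
    rw [mem_prod, mem_Ioo, mem_ball] at hb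
    have hQ1 : ((0 : ℝ), x) ∈ parabolicCylinder 1 z := by
      rw [mem_parabolicCylinder]
      exact ⟨⟨by simp only; linarith [hb.1.1], hs⟩, by simp only; linarith [hb.2]⟩
    have h3 := h13 ⟨hmem, hQ1⟩
    rw [rad_one]
    exact parabolicCylinder_mono (by norm_num) (by norm_num) z h3
  -- the slice sets of the ring decomposition
  set Sj : ℕ → Set (EuclideanSpace ℝ (Fin 3)) := fun j =>
    {x | ((0 : ℝ), x) ∈ parabolicCylinder (rad j) z \ parabolicCylinder (rad (j + 1)) z} with hSj
  set Sc : Set (EuclideanSpace ℝ (Fin 3)) := {x | ((0 : ℝ), x) ∈ parabolicCylinder r z} with hSc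
  have hmeasQ : ∀ ρ' : ℝ, MeasurableSet (parabolicCylinder ρ' z) := fun ρ' =>
    (isOpen_parabolicCylinder ρ' z).measurableSet
  have hSjm : ∀ j, MeasurableSet (Sj j) := fun j =>
    measurable_prodMk_left ((hmeasQ _).diff (hmeasQ _))
  have hScm : MeasurableSet Sc := measurable_prodMk_left (hmeasQ _)
  set U : Set (EuclideanSpace ℝ (Fin 3)) := (⋃ j : ↥(Finset.Icc 1 n), Sj (j : ℕ)) ∪ Sc with hU
  have hUm : MeasurableSet U := (MeasurableSet.iUnion fun j => hSjm _).union hScm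
  have hcover : ∀ x, φ 0 x ≠ 0 → x ∈ U := by
    intro x hx
    have h := parabolicCylinder_radOne_subset_rings z n (hslice x hx)
    rcases h with h | h
    · obtain ⟨j, hj⟩ := mem_iUnion.1 h
      exact Or.inl (mem_iUnion.2 ⟨j, hj⟩)
    · exact Or.inr h
  set f : EuclideanSpace ℝ (Fin 3) → ℝ≥0∞ := fun x => ‖u₀ x‖ₑ ^ 2 * ENNReal.ofReal (φ 0 x) with hf
  have hfU : f = U.indicator f := by
    funext x
    by_cases hx : x ∈ U
    · rw [indicator_of_mem hx]
    · rw [indicator_of_notMem hx]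
      have h0 : φ 0 x = 0 := by
        by_contra h
        exact hx (hcover x h)
      simp only [hf, h0, ENNReal.ofReal_zero, mul_zero]
  -- ring and core bounds on the slice
  have hring_le : ∀ j ∈ Finset.Icc 1 n, ∫⁻ x in Sj j, f x ≤
      ENNReal.ofReal (C₁ * r ^ 2 * ((rad (j + 1)) ^ 3)⁻¹) * ENNReal.ofReal (N * rad j) := by
    intro j hj
    obtain ⟨hj1, hjn⟩ := Finset.mem_Icc.1 hj
    have hsub : Sj j ⊆ ball z.2 (rad j) := fun x hx => by
      have h1 := (mem_parabolicCylinder.1 hx.1).2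
      exact mem_ball.2 h1
    calc ∫⁻ x in Sj j, f x
        ≤ ∫⁻ x in Sj j, ‖u₀ x‖ₑ ^ 2 * ENNReal.ofReal (C₁ * r ^ 2 * ((rad (j + 1)) ^ 3)⁻¹) := by
          refine setLIntegral_mono' (hSjm j) fun x hx => ?_
          simp only [hf]
          gcongr
          exact hring j hj1 (by omega) _ hx
      _ = (∫⁻ x in Sj j, ‖u₀ x‖ₑ ^ 2) * ENNReal.ofReal (C₁ * r ^ 2 * ((rad (j + 1)) ^ 3)⁻¹) :=
          lintegral_mul_const' _ _ ENNReal.ofReal_ne_top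
      _ ≤ (∫⁻ x in ball z.2 (rad j), ‖u₀ x‖ₑ ^ 2) * ENNReal.ofReal (C₁ * r ^ 2 * ((rad (j + 1)) ^ 3)⁻¹) := by
          gcongr 1; exact lintegral_mono_set hsub
      _ ≤ ENNReal.ofReal (N * rad j) * ENNReal.ofReal (C₁ * r ^ 2 * ((rad (j + 1)) ^ 3)⁻¹) := by
          gcongr; exact hN (rad j) (rad_pos j) (rad_le_one j)
      _ = _ := mul_comm _ _
  have hcore_le : ∫⁻ x in Sc, f x ≤ ENNReal.ofReal (C₁ * r⁻¹) * ENNReal.ofReal (N * r) := by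
    have hsub : Sc ⊆ ball z.2 r := fun x hx => mem_ball.2 (mem_parabolicCylinder.1 hx).2
    calc ∫⁻ x in Sc, f x
        ≤ ∫⁻ x in Sc, ‖u₀ x‖ₑ ^ 2 * ENNReal.ofReal (C₁ * r⁻¹) := by
          refine setLIntegral_mono' hScm fun x hx => ?_
          simp only [hf]
          gcongr
          exact hcore _ hx
      _ = (∫⁻ x in Sc, ‖u₀ x‖ₑ ^ 2) * ENNReal.ofReal (C₁ * r⁻¹) :=
          lintegral_mul_const' _ _ ENNReal.ofReal_ne_top
      _ ≤ (∫⁻ x in ball z.2 r, ‖u₀ x‖ₑ ^ 2) * ENNReal.ofReal (C₁ * r⁻¹) := by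
          gcongr 1; exact lintegral_mono_set hsub
      _ ≤ ENNReal.ofReal (N * r) * ENNReal.ofReal (C₁ * r⁻¹) := by
          gcongr; exact hN r hr (rad_le_one _)
      _ = _ := mul_comm _ _
  -- assemble
  calc ∫⁻ x, f x = ∫⁻ x in U, f x := by
        conv_lhs => rw [hfU]
        exact lintegral_indicator hUm _
    _ ≤ (∫⁻ x in ⋃ j : ↥(Finset.Icc 1 n), Sj (j : ℕ), f x) + ∫⁻ x in Sc, f x :=
        lintegral_union_le _ _ _
    _ ≤ (∑' j : ↥(Finset.Icc 1 n), ∫⁻ x in Sj (j : ℕ), f x) + ∫⁻ x in Sc, f x := by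
        gcongr; exact lintegral_iUnion_le _ _
    _ = (∑ j ∈ Finset.Icc 1 n, ∫⁻ x in Sj j, f x) + ∫⁻ x in Sc, f x := by
        rw [tsum_fintype]
        congr 1
        exact Finset.sum_coe_sort (Finset.Icc 1 n) (fun j : ℕ => ∫⁻ x in Sj j, f x)
    _ ≤ (∑ j ∈ Finset.Icc 1 n, ENNReal.ofReal (C₁ * r ^ 2 * ((rad (j + 1)) ^ 3)⁻¹) *
          ENNReal.ofReal (N * rad j)) + ENNReal.ofReal (C₁ * r⁻¹) * ENNReal.ofReal (N * r) :=
        add_le_add (Finset.sum_le_sum hring_le) hcore_le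
    _ = ENNReal.ofReal (8 * C₁ * N * r ^ 2 * ∑ j ∈ Finset.Icc 1 n, ((rad j) ^ 2)⁻¹) +
          ENNReal.ofReal (C₁ * N) := by
        congr 1
        · rw [Finset.mul_sum, ENNReal.ofReal_sum_of_nonneg (fun j _ => by
            have := rad_pos j; positivity)]
          refine Finset.sum_congr rfl fun j _ => ?_
          have hj := rad_pos j
          have hj1 := rad_pos (j + 1)
          rw [← ENNReal.ofReal_mul (by positivity)]
          congr 1
          rw [rad_succ]
          field_simp
          ring
        · rw [← ENNReal.ofReal_mul (by positivity)]
          congr 1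
          field_simp
    _ ≤ ENNReal.ofReal (4 * C₁ * N) := by
        rw [← ENNReal.ofReal_add (by
          have := Finset.sum_nonneg fun j (_ : j ∈ Finset.Icc 1 n) =>
            (show (0 : ℝ) ≤ ((rad j) ^ 2)⁻¹ by have := rad_pos j; positivity)
          positivity) (by positivity)]
        refine ENNReal.ofReal_le_ofReal ?_
        have h1 := sum_Icc_inv_rad_sq_le n
        rw [← hr_def] at h1
        have hkey : 8 * C₁ * N * r ^ 2 * ∑ j ∈ Finset.Icc 1 n, ((rad j) ^ 2)⁻¹ ≤ 8 / 3 * C₁ * N := by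
          calc 8 * C₁ * N * r ^ 2 * ∑ j ∈ Finset.Icc 1 n, ((rad j) ^ 2)⁻¹
              ≤ 8 * C₁ * N * r ^ 2 * (1 / 3 * (r ^ 2)⁻¹) := by gcongr
            _ = 8 / 3 * C₁ * N := by field_simp
        nlinarith [mul_nonneg hC hN0]

/-- The real form of `lintegral_datum_le`: `∫ |u₀|² φ(0, ·) ≤ 4 C₁ N` (the Bochner integral of a
nonnegative function is dominated by the corresponding lower Lebesgue integral, and vanishes if
the function is not integrable). [folklore] -/
theorem integral_datum_le {u₀ : EuclideanSpace ℝ (Fin 3) → EuclideanSpace ℝ (Fin 3)}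
    {N C₁ : ℝ} (hN0 : 0 ≤ N) (hC : 0 ≤ C₁) (hs : 0 < z.1)
    (hN : ∀ ρ' : ℝ, 0 < ρ' → ρ' ≤ 1 → ∫⁻ x in ball z.2 ρ', ‖u₀ x‖ₑ ^ 2 ≤ ENNReal.ofReal (N * ρ'))
    (hφ0 : ∀ t x, 0 ≤ φ t x) {ρ : ℝ}
    (hbox : support (uncurry φ) ⊆ Ioo (z.1 - 1 / 9) (z.1 + ρ) ×ˢ ball z.2 (1 / 2))
    (h13 : support (uncurry φ) ∩ parabolicCylinder 1 z ⊆ parabolicCylinder (1 / 3) z)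
    (hcore : ∀ w ∈ parabolicCylinder (rad (n + 1)) z, φ w.1 w.2 ≤ C₁ * (rad (n + 1))⁻¹)
    (hring : ∀ j : ℕ, 1 ≤ j → j + 1 ≤ n + 1 →
      ∀ w ∈ parabolicCylinder (rad j) z \ parabolicCylinder (rad (j + 1)) z,
        φ w.1 w.2 ≤ C₁ * (rad (n + 1)) ^ 2 * ((rad (j + 1)) ^ 3)⁻¹) :
    (∫ x, ‖u₀ x‖ ^ 2 * φ 0 x) ≤ 4 * C₁ * N := by
  have hL := lintegral_datum_le (n := n) hN0 hC hs hN hbox h13 hcore hring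
  have hnn : ∀ x, 0 ≤ ‖u₀ x‖ ^ 2 * φ 0 x := fun x => mul_nonneg (sq_nonneg _) (hφ0 _ _)
  by_cases hI : Integrable (fun x => ‖u₀ x‖ ^ 2 * φ 0 x) volume
  · rw [integral_eq_lintegral_of_nonneg_ae (Eventually.of_forall hnn) hI.aestronglyMeasurable]
    refine ENNReal.toReal_le_of_le_ofReal (by positivity) (le_trans (le_of_eq ?_) hL)
    refine lintegral_congr fun x => ?_
    rw [ENNReal.ofReal_mul (sq_nonneg _), ENNReal.ofReal_pow (norm_nonneg _), ofReal_norm]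
  · rw [integral_undef hI]
    positivity

/-- Under the integrability of `|u|³` and `|p|^{3/2}` on `Q_1(z₀)` (and the local integrability of
`u`, `p`), the flux `(|u|² + 2p) u` is locally integrable on `Q_1(z₀)` (Young; the proof of the
accepted `IsSuitablePair.locallyIntegrableOn_cubic`). [folklore] -/
theorem locallyIntegrableOn_cubic'
    (hu_li : LocallyIntegrableOn (uncurry u) (parabolicCylinder 1 z₀) volume)
    (hp_li : LocallyIntegrableOn (uncurry p) (parabolicCylinder 1 z₀) volume)
    (hu3 : ∫⁻ w in parabolicCylinder 1 z₀, ‖u w.1 w.2‖ₑ ^ (3 : ℕ) ≠ ∞)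
    (hp32 : ∫⁻ w in parabolicCylinder 1 z₀, ‖p w.1 w.2‖ₑ ^ (3 / 2 : ℝ) ≠ ∞) :
    LocallyIntegrableOn (uncurry fun t x => (‖u t x‖ ^ 2 + 2 * p t x) • u t x)
      (parabolicCylinder 1 z₀) volume := by
  set Q1 := parabolicCylinder 1 z₀ with hQ1
  have hu : AEStronglyMeasurable (uncurry u) (volume.restrict Q1) := hu_li.aestronglyMeasurable
  have hp : AEStronglyMeasurable (uncurry p) (volume.restrict Q1) := hp_li.aestronglyMeasurable
  have hI3 : IntegrableOn (fun w : ℝ × EuclideanSpace ℝ (Fin 3) => ‖u w.1 w.2‖ ^ 3) Q1 volume :=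
    integrableOn_cube_of_lintegral hu hu3
  have hI32 : IntegrableOn (fun w : ℝ × EuclideanSpace ℝ (Fin 3) => |p w.1 w.2| ^ (3 / 2 : ℝ)) Q1 volume := by
    have hm : AEStronglyMeasurable (fun w : ℝ × EuclideanSpace ℝ (Fin 3) => |p w.1 w.2| ^ (3 / 2 : ℝ))
        (volume.restrict Q1) := by
      have e : (fun w : ℝ × EuclideanSpace ℝ (Fin 3) => |p w.1 w.2| ^ (3 / 2 : ℝ)) =
          fun w => ‖uncurry p w‖ ^ (3 / 2 : ℝ) := by
        funext w; rw [Real.norm_eq_abs]; rfl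
      rw [e]
      exact (hp.aemeasurable.norm.pow_const _).aestronglyMeasurable
    refine ⟨hm, ?_⟩
    rw [hasFiniteIntegral_iff_enorm]
    refine lt_of_le_of_lt (lintegral_mono fun w => le_of_eq ?_) (lt_top_iff_ne_top.2 hp32)
    rw [Real.enorm_eq_ofReal (Real.rpow_nonneg (abs_nonneg _) _), Real.enorm_eq_ofReal_abs,
      ENNReal.ofReal_rpow_of_nonneg (abs_nonneg _) (by norm_num)]
  have hIall : IntegrableOn (uncurry fun t x => (‖u t x‖ ^ 2 + 2 * p t x) • u t x) Q1 volume := by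
    have hm : AEStronglyMeasurable (uncurry fun t x => (‖u t x‖ ^ 2 + 2 * p t x) • u t x)
        (volume.restrict Q1) := by
      have e : (uncurry fun t x => (‖u t x‖ ^ 2 + 2 * p t x) • u t x) =
          fun w : ℝ × EuclideanSpace ℝ (Fin 3) => (‖uncurry u w‖ ^ 2 + 2 * uncurry p w) • uncurry u w := by
        funext w; rfl
      rw [e]
      exact ((hu.norm.pow 2).add (hp.const_mul 2)).smul hu
    refine Integrable.mono' ((hI3.const_mul (5 / 3)).add (hI32.const_mul (4 / 3))) hm
      (Eventually.of_forall fun w => ?_)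
    have hpq : (3 / 2 : ℝ).HolderConjugate 3 := Real.holderConjugate_iff.2 ⟨by norm_num, by norm_num⟩
    have hy := Real.young_inequality_of_nonneg (abs_nonneg (p w.1 w.2)) (norm_nonneg (u w.1 w.2)) hpq
    simp only [uncurry, norm_smul, Real.norm_eq_abs, Pi.add_apply]
    have h3 : ‖u w.1 w.2‖ ^ (3 : ℝ) = ‖u w.1 w.2‖ ^ 3 := by
      rw [show (3 : ℝ) = ((3 : ℕ) : ℝ) by norm_num, Real.rpow_natCast]
    rw [h3] at hy
    have hu0 := norm_nonneg (u w.1 w.2)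
    calc |‖u w.1 w.2‖ ^ 2 + 2 * p w.1 w.2| * ‖u w.1 w.2‖
        ≤ (‖u w.1 w.2‖ ^ 2 + 2 * |p w.1 w.2|) * ‖u w.1 w.2‖ := by
          gcongr
          exact (abs_add_le _ _).trans (by rw [abs_of_nonneg (sq_nonneg _), abs_mul, abs_two])
      _ = ‖u w.1 w.2‖ ^ 3 + 2 * (|p w.1 w.2| * ‖u w.1 w.2‖) := by ring
      _ ≤ ‖u w.1 w.2‖ ^ 3 + 2 * (|p w.1 w.2| ^ (3 / 2 : ℝ) / (3 / 2) + ‖u w.1 w.2‖ ^ 3 / 3) := by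
          gcongr
      _ = 5 / 3 * ‖u w.1 w.2‖ ^ 3 + 4 / 3 * |p w.1 w.2| ^ (3 / 2 : ℝ) := by ring
  exact hIall.locallyIntegrableOn

end Bounds

/-! ### Step 2 assembled -/

section Final

set_option maxHeartbeats 1600000 in
/-- **Step 2 of the initial-time induction** (`{(A'_k)}_{1 ≤ k ≤ n} ⟹ (B'_{n+1})` in the
scale-invariant normalisation; Robinson–Rodrigo–Sadowski 2016, proof of Thm. 15.3, Step 2,
pp. 221–223, with the datum term). There is an absolute `C_B ≥ 1` such that: for a triple
`(u, p, G)` on `Q_1(z₀)` with `G` the weak spatial gradient of `u`, `∫∫_{Q_1(z₀)} |G|² < ∞`, `p`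
locally integrable with `∫∫_{Q_1(z₀)} |p|^{3/2} < ∞`, `div u = 0` in `𝒟'(Q_1(z₀))`, and the local
energy inequality **with the datum term** `∫ |u₀|² φ(0,·)` for all nonnegative tests on `Q_1(z₀)`
(unit viscosity, no force); for `ε₀ > 0` with `∫∫_{Q_1(z₀)} (|u|³ + |p|^{3/2}) ≤ ε₀`; for
`z = (s, a) ∈ Q_{1/2}(z₀)` at which the datum is Morrey-small, `∫_{B_ρ(a)} |u₀|² ≤ ε₀^{2/3} ρ`
(`0 < ρ ≤ 1`); and for `n ≥ 1`: if `C(r_k) + D_osc(r_k) ≤ ε₀^{2/3}` at `z` for `1 ≤ k ≤ n`, then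
`A_ess(r_{n+1}) + E(r_{n+1}) ≤ C_B ε₀^{2/3}` at `z`. Proof: test the sliced inequality
(`ae_localEnergy_slice_datum_of_forall_lt`) with `φ_{n+1}` of Lemma 15.11; the right-hand side
below any level `t < s` is at most `(C₁ + 10 C₁ + 2 c' C₁) ε₀^{2/3}` (quadratic term by the
smallness assumption, cubic and pressure terms by the ring sums of this file), the datum term at
most `4 C₁ ε₀^{2/3}` (`integral_datum_le`; absent if `s ≤ 0`); the lower bound `φ ≥ C₁⁻¹ r⁻¹` on
`Q_r(z)` then gives `A_ess ≤ C₁ M`, `E ≤ C₁ M / 2`, `M = (15 + 2c') C₁ ε₀^{2/3}`;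
`C_B = (3/2) C₁² (15 + 2c')`, `c' = 256 + 136 c_χ`. [cite: RobinsonRodrigoSadowski2016, proof of Thm. 15.3, Step 2, pp. 221–223; BarkerPrange2020, Thm. 1] -/
theorem initialStep2 (h11 : lemma15_11) :
    ∃ CB : ℝ, 1 ≤ CB ∧
      ∀ (z₀ : ℝ × EuclideanSpace ℝ (Fin 3))
        (u₀ : EuclideanSpace ℝ (Fin 3) → EuclideanSpace ℝ (Fin 3))
        (u : ℝ → EuclideanSpace ℝ (Fin 3) → EuclideanSpace ℝ (Fin 3))
        (p : ℝ → EuclideanSpace ℝ (Fin 3) → ℝ)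
        (G : ℝ → EuclideanSpace ℝ (Fin 3) → EuclideanSpace ℝ (Fin 3) →L[ℝ] EuclideanSpace ℝ (Fin 3)),
        HasWeakSpatialGradientOn (parabolicCylinderOpens 1 z₀) u G →
        ∫⁻ w in parabolicCylinder 1 z₀, ENNReal.ofReal (frobeniusNormSq (G w.1 w.2)) < ∞ →
        LocallyIntegrableOn (uncurry p) (parabolicCylinder 1 z₀) volume →
        ∫⁻ w in parabolicCylinder 1 z₀, ‖p w.1 w.2‖ₑ ^ (3 / 2 : ℝ) < ∞ →
        (∀ θ : ℝ → EuclideanSpace ℝ (Fin 3) → ℝ, IsSpaceTimeTestOn (parabolicCylinderOpens 1 z₀) θ →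
          ∫ w in parabolicCylinder 1 z₀, ⟪u w.1 w.2, gradient (θ w.1) w.2⟫ = 0) →
        (∀ φ : ℝ → EuclideanSpace ℝ (Fin 3) → ℝ, IsSpaceTimeTestOn (parabolicCylinderOpens 1 z₀) φ →
          (∀ t x, 0 ≤ φ t x) →
          2 * 1 * ∫ t, ∫ x, frobeniusNormSq (G t x) * φ t x ≤
            (∫ x, ‖u₀ x‖ ^ 2 * φ 0 x) +
            ∫ t, ∫ x, (‖u t x‖ ^ 2 * (timeDeriv φ t x + 1 * Δ (φ t) x) +
              (‖u t x‖ ^ 2 + 2 * p t x) * ⟪u t x, gradient (φ t) x⟫)) →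
        ∀ ε₀ : ℝ, 0 < ε₀ → Small ε₀ u p z₀ →
          ∀ z ∈ parabolicCylinder (1 / 2) z₀,
            (∀ ρ : ℝ, 0 < ρ → ρ ≤ 1 →
              ∫⁻ x in ball z.2 ρ, ‖u₀ x‖ₑ ^ 2 ≤ ENNReal.ofReal (ε₀ ^ (2 / 3 : ℝ) * ρ)) →
            ∀ n : ℕ, 1 ≤ n →
              (∀ k : ℕ, 1 ≤ k → k ≤ n →
                cknC (rad k) z u + cknDOsc (rad k) z p ≤ ENNReal.ofReal (ε₀ ^ (2 / 3 : ℝ))) →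
              cknAEss (rad (n + 1)) z u + cknE (rad (n + 1)) z G ≤
                ENNReal.ofReal (CB * ε₀ ^ (2 / 3 : ℝ)) := by
  classical
  obtain ⟨C₁, hC1, hφex⟩ := h11
  obtain ⟨cχ, hcχ0, hcχ⟩ := exists_norm_fderiv_cylCut_le
  have hC0 : 0 ≤ C₁ := zero_le_one.trans hC1
  set c' : ℝ := 256 + 136 * cχ with hc'
  have hc'0 : 0 ≤ c' := by positivity
  refine ⟨C₁ ^ 2 * (3 / 2) * (15 + 2 * c'), ?_, ?_⟩
  · have h1 : (1 : ℝ) ≤ C₁ ^ 2 := by nlinarith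
    nlinarith
  intro z₀ u₀ u p G hG hG2fin hp_li hp32fin hdiv hLEI ε₀ hε hsmall z hz hN n hn hA
  -- the test function `φ = φ_{n+1}`
  obtain ⟨φ, hφs, hφc, hφ0, hbox, hcore, hring, h13, hheat⟩ := hφex z (n + 1) (by omega)
  set r := rad (n + 1) with hr_def
  have hr : 0 < r := rad_pos _
  have hr1 : r ≤ 1 := rad_le_one _
  set Q1 := parabolicCylinder 1 z₀ with hQ1
  have hQ1fin : volume Q1 < ∞ := (volume_parabolicCylinder_le zero_le_one z₀).trans_lt ENNReal.ofReal_lt_top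
  -- primitive data
  have hu_li : LocallyIntegrableOn (uncurry u) Q1 volume := hG.locallyIntegrableOn
  have hu : AEStronglyMeasurable (uncurry u) (volume.restrict Q1) := hu_li.aestronglyMeasurable
  have hp : AEStronglyMeasurable (uncurry p) (volume.restrict Q1) := hp_li.aestronglyMeasurable
  have hf : AEStronglyMeasurable (uncurry (0 : ℝ → EuclideanSpace ℝ (Fin 3) → EuclideanSpace ℝ (Fin 3)))
      (volume.restrict Q1) := aestronglyMeasurable_const
  have hG2K : ∀ K ⊆ Q1, IsCompact K → ∫⁻ w in K, ENNReal.ofReal (frobeniusNormSq (G w.1 w.2)) < ∞ :=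
    fun K hK _ => (lintegral_mono_set hK).trans_lt hG2fin
  have hGl := locallyIntegrableOn_frobeniusNormSq hG hG2K
  have hGm : AEStronglyMeasurable (fun w : ℝ × EuclideanSpace ℝ (Fin 3) => frobeniusNormSq (G w.1 w.2))
      (volume.restrict Q1) := hGl.aestronglyMeasurable
  have hu3 : ∫⁻ w in Q1, ‖u w.1 w.2‖ₑ ^ (3 : ℕ) ≠ ∞ :=
    ne_top_of_le_ne_top ENNReal.ofReal_ne_top ((lintegral_mono fun w => le_self_add).trans hsmall)
  have hp32 : ∫⁻ w in Q1, ‖p w.1 w.2‖ₑ ^ (3 / 2 : ℝ) ≠ ∞ := hp32fin.ne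
  have hG2 : ∫⁻ w in Q1, ENNReal.ofReal (frobeniusNormSq (G w.1 w.2)) ≠ ∞ := hG2fin.ne
  have hf32 : ∫⁻ w in Q1, ‖(0 : ℝ → EuclideanSpace ℝ (Fin 3) → EuclideanSpace ℝ (Fin 3)) w.1 w.2‖ₑ ^
      (3 / 2 : ℝ) ≠ ∞ := by
    simp only [Pi.zero_apply, enorm_zero]
    rw [ENNReal.zero_rpow_of_pos (by norm_num), lintegral_zero]
    exact ENNReal.zero_ne_top
  have hsq : LocallyIntegrableOn (fun w : ℝ × EuclideanSpace ℝ (Fin 3) => ‖u w.1 w.2‖ ^ 2) Q1 volume :=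
    (integrableOn_sq_of_cube hQ1fin hu (integrableOn_cube_of_lintegral hu hu3)).locallyIntegrableOn
  have hcub := locallyIntegrableOn_cubic' hu_li hp_li hu3 hp32
  have hφtop : IsSpaceTimeTestOn (⊤ : Opens (ℝ × EuclideanSpace ℝ (Fin 3))) φ :=
    ⟨hφs, hφc, fun _ _ => trivial⟩
  have hζQ := tsupport_inter_subset_of_box hz hbox h13
  have hε23 : 0 ≤ ε₀ ^ (2 / 3 : ℝ) := Real.rpow_nonneg hε.le _
  -- the bound `M` on the right-hand side (with the datum term)
  set M : ℝ := (15 + 2 * c') * C₁ * ε₀ ^ (2 / 3 : ℝ) with hM_def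
  have hM0 : 0 ≤ M := by positivity
  -- the datum term
  have hDat : (if 0 < z.1 then (∫ x, ‖u₀ x‖ ^ 2 * φ 0 x) else 0) ≤ 4 * C₁ * ε₀ ^ (2 / 3 : ℝ) := by
    split_ifs with hs
    · exact integral_datum_le (n := n) hε23 hC0 hs hN hφ0 hbox h13
        (fun w hw => (hcore w hw).2.1) (fun j hj hjn w hw => (hring j hj hjn w hw).1)
    · positivity
  -- Claim R: the right-hand side below a level `t < s`
  have hR : ∀ t < z.1, ∫ w in {w : ℝ × EuclideanSpace ℝ (Fin 3) | w.1 < t}, localEnergyRHS 1 0 u p φ w ≤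
      (11 + 2 * c') * C₁ * ε₀ ^ (2 / 3 : ℝ) := by
    intro t ht
    set T : Set (ℝ × EuclideanSpace ℝ (Fin 3)) := {w | w.1 < t} with hT_def
    have hTm : MeasurableSet T := measurableSet_lt measurable_fst measurable_const
    obtain ⟨hIA, hIB, hIP, hID, -, -⟩ :=
      integrableOn_pieces (ν := 1) hz hu hp hf hGm hu3 hp32 hf32 hG2 hφtop hbox h13 ht.le
    have bA := abs_setIntegral_quadratic_le hz hu hε.le hsmall hbox h13
      (C := C₁ * r ^ 2) (by positivity) hheat ht.le
    have bB := abs_setIntegral_cubic_le' (u := u) (p := p) hn hε.le hC0 hA hφtop hbox h13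
      (fun j hj hjn w hw => (hring j hj hjn w hw).2) (fun w hw => (hcore w hw).2.2) ht.le
    have bP := abs_setIntegral_pressure_le' hu_li hp hdiv hn hz hu3 hp32 hε.le hC0 hcχ0 (hcχ z) hA hφs hφc
      hφ0 hbox h13 (fun w hw => ⟨(hcore w hw).2.1, (hcore w hw).2.2⟩) hring ht
    have e1 : ∫ w in T, localEnergyRHS 1 0 u p φ w =
        (∫ w in T, ‖u w.1 w.2‖ ^ 2 * (timeDeriv φ w.1 w.2 + 1 * Δ (φ w.1) w.2)) +
          (∫ w in T, (‖u w.1 w.2‖ ^ 2 + 2 * p w.1 w.2) * ⟪u w.1 w.2, gradient (φ w.1) w.2⟫) +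
          ∫ w in T, 2 * ⟪(0 : ℝ → EuclideanSpace ℝ (Fin 3) → EuclideanSpace ℝ (Fin 3)) w.1 w.2, u w.1 w.2⟫ *
            φ w.1 w.2 := by
      have hIMid : IntegrableOn (fun w : ℝ × EuclideanSpace ℝ (Fin 3) =>
          (‖u w.1 w.2‖ ^ 2 + 2 * p w.1 w.2) * ⟪u w.1 w.2, gradient (φ w.1) w.2⟫) T volume :=
        (hIB.add (hIP.const_mul 2)).congr_fun (fun w _ => by simp only [Pi.add_apply]; ring) hTm
      have hIAM : IntegrableOn (fun w : ℝ × EuclideanSpace ℝ (Fin 3) =>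
          ‖u w.1 w.2‖ ^ 2 * (timeDeriv φ w.1 w.2 + 1 * Δ (φ w.1) w.2) +
            (‖u w.1 w.2‖ ^ 2 + 2 * p w.1 w.2) * ⟪u w.1 w.2, gradient (φ w.1) w.2⟫) T volume := hIA.add hIMid
      rw [← integral_add hIA hIMid, ← integral_add hIAM hID]
      rfl
    have e2 : ∫ w in T, (‖u w.1 w.2‖ ^ 2 + 2 * p w.1 w.2) * ⟪u w.1 w.2, gradient (φ w.1) w.2⟫ =
        (∫ w in T, ‖u w.1 w.2‖ ^ 2 * ⟪u w.1 w.2, gradient (φ w.1) w.2⟫) +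
          2 * ∫ w in T, p w.1 w.2 * ⟪u w.1 w.2, gradient (φ w.1) w.2⟫ := by
      rw [← integral_const_mul, ← integral_add hIB (hIP.const_mul 2)]
      exact integral_congr_ae (Eventually.of_forall fun w => by ring)
    have e3 : ∫ w in T, 2 * ⟪(0 : ℝ → EuclideanSpace ℝ (Fin 3) → EuclideanSpace ℝ (Fin 3)) w.1 w.2, u w.1 w.2⟫ *
        φ w.1 w.2 = 0 := by
      simp only [Pi.zero_apply, inner_zero_left, mul_zero, zero_mul, integral_zero]
    rw [e1, e2, e3]
    have key : ∀ {x b : ℝ}, |x| ≤ b → x ≤ b := fun h => (le_abs_self _).trans h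
    have hAle := key bA
    have hBle := key bB
    have hPle : 2 * ∫ w in T, p w.1 w.2 * ⟪u w.1 w.2, gradient (φ w.1) w.2⟫ ≤
        2 * ((256 + 136 * cχ) * C₁ * ε₀ ^ (2 / 3 : ℝ)) :=
      mul_le_mul_of_nonneg_left (key bP) zero_le_two
    have hr2 : C₁ * r ^ 2 * ε₀ ^ (2 / 3 : ℝ) ≤ C₁ * ε₀ ^ (2 / 3 : ℝ) := by
      have : r ^ 2 ≤ 1 := pow_le_one₀ hr.le hr1
      nlinarith [mul_nonneg hC0 hε23]
    rw [hc']
    nlinarith [hAle, hBle, hPle, hr2]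
  -- Claim S: the sliced local energy inequality below `s`, with the datum term
  have hslice := ae_localEnergy_slice_datum_of_forall_lt (Q := parabolicCylinderOpens 1 z₀) (ν := 1)
    hLEI hsq hGl hcub hφtop hφ0 hζQ
  have hmeasS : ∀ t : ℝ, MeasurableSet {w : ℝ × EuclideanSpace ℝ (Fin 3) | w.1 < t} := fun t =>
    measurableSet_lt measurable_fst measurable_const
  have hGφ0 : ∀ w : ℝ × EuclideanSpace ℝ (Fin 3), 0 ≤ frobeniusNormSq (G w.1 w.2) * φ w.1 w.2 := fun w =>
    mul_nonneg (frobeniusNormSq_nonneg _) (hφ0 _ _)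
  have hgood : ∀ᵐ t ∂(volume : Measure ℝ), t < z.1 →
      (∫ x, ‖u t x‖ ^ 2 * φ t x) ≤ M ∧
        ∫ w in {w : ℝ × EuclideanSpace ℝ (Fin 3) | w.1 < t}, frobeniusNormSq (G w.1 w.2) * φ w.1 w.2 ≤ M / 2 := by
    filter_upwards [hslice] with t ht hts
    have h := ht hts
    have hRt := hR t hts
    have hE0 : 0 ≤ ∫ x, ‖u t x‖ ^ 2 * φ t x := integral_nonneg fun x => mul_nonneg (sq_nonneg _) (hφ0 _ _)
    have hD0 : 0 ≤ ∫ w in {w : ℝ × EuclideanSpace ℝ (Fin 3) | w.1 < t}, frobeniusNormSq (G w.1 w.2) * φ w.1 w.2 :=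
      setIntegral_nonneg (hmeasS t) fun w _ => hGφ0 w
    have hM' : 4 * C₁ * ε₀ ^ (2 / 3 : ℝ) + (11 + 2 * c') * C₁ * ε₀ ^ (2 / 3 : ℝ) = M := by
      rw [hM_def]; ring
    constructor <;> nlinarith
  -- integrability of `|G|² φ` and `|u|² φ` below `s`
  obtain ⟨-, -, -, -, hIGφ, hIUφ⟩ :=
    integrableOn_pieces (ν := 1) hz hu hp hf hGm hu3 hp32 hf32 hG2 hφtop hbox h13 (le_refl z.1)
  ------------------------------------------------------------------
  -- (E1) the energy: `cknAEss r z u ≤ C₁ M`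
  ------------------------------------------------------------------
  have hslint : ∀ᵐ t ∂(volume : Measure ℝ), t < z.1 → Integrable (fun x => ‖u t x‖ ^ 2 * φ t x) volume := by
    have hI : Integrable ({w : ℝ × EuclideanSpace ℝ (Fin 3) | w.1 < z.1}.indicator
        fun w : ℝ × EuclideanSpace ℝ (Fin 3) => ‖u w.1 w.2‖ ^ 2 * φ w.1 w.2)
        ((volume : Measure ℝ).prod (volume : Measure (EuclideanSpace ℝ (Fin 3)))) := by
      rw [← Measure.volume_eq_prod]
      exact (integrable_indicator_iff (hmeasS z.1)).2 hIUφ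
    filter_upwards [hI.prod_right_ae] with t ht hts
    have e : (fun x => {w : ℝ × EuclideanSpace ℝ (Fin 3) | w.1 < z.1}.indicator
        (fun w : ℝ × EuclideanSpace ℝ (Fin 3) => ‖u w.1 w.2‖ ^ 2 * φ w.1 w.2) (t, x)) =
        fun x => ‖u t x‖ ^ 2 * φ t x := by
      funext x
      rw [indicator_of_mem (show (t, x) ∈ {w : ℝ × EuclideanSpace ℝ (Fin 3) | w.1 < z.1} from hts)]
    rw [e] at ht
    exact ht
  have hE1 : cknAEss r z u ≤ ENNReal.ofReal (C₁ * M) := by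
    rw [cknAEss]
    refine essSup_le_of_ae_le _ ?_
    have h1 := ae_restrict_of_ae (s := Ioo (z.1 - r ^ 2) z.1) hgood
    have h2 := ae_restrict_of_ae (s := Ioo (z.1 - r ^ 2) z.1) hslint
    filter_upwards [h1, h2, ae_restrict_mem measurableSet_Ioo] with t ht1 ht2 htI
    have hts : t < z.1 := htI.2
    obtain ⟨hEt, -⟩ := ht1 hts
    have hint := ht2 hts
    have hlow : ∀ x ∈ ball z.2 r, 1 ≤ C₁ * r * φ t x := by
      intro x hx
      have hmem : (t, x) ∈ parabolicCylinder r z := by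
        rw [mem_parabolicCylinder]; exact ⟨htI, mem_ball.1 hx⟩
      have h := (hcore (t, x) hmem).1
      have hCr : 0 < C₁ * r := by positivity
      calc (1 : ℝ) = C₁ * r * (C₁⁻¹ * r⁻¹) := by field_simp
        _ ≤ C₁ * r * φ t x := mul_le_mul_of_nonneg_left h hCr.le
    calc (ENNReal.ofReal r)⁻¹ * ∫⁻ x in ball z.2 r, ‖u t x‖ₑ ^ 2
        ≤ (ENNReal.ofReal r)⁻¹ * ∫⁻ x in ball z.2 r, ‖u t x‖ₑ ^ 2 * ENNReal.ofReal (C₁ * r * φ t x) := by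
          refine mul_le_mul_right (setLIntegral_mono' measurableSet_ball fun x hx => ?_) _
          calc ‖u t x‖ₑ ^ 2 = ‖u t x‖ₑ ^ 2 * 1 := (mul_one _).symm
            _ ≤ ‖u t x‖ₑ ^ 2 * ENNReal.ofReal (C₁ * r * φ t x) := by
                refine mul_le_mul_right ?_ _
                rw [← ENNReal.ofReal_one]
                exact ENNReal.ofReal_le_ofReal (hlow x hx)
      _ ≤ (ENNReal.ofReal r)⁻¹ * ∫⁻ x, ‖u t x‖ₑ ^ 2 * ENNReal.ofReal (C₁ * r * φ t x) :=
          mul_le_mul_right (lintegral_mono' Measure.restrict_le_self le_rfl) _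
      _ = (ENNReal.ofReal r)⁻¹ * (ENNReal.ofReal (C₁ * r) * ENNReal.ofReal (∫ x, ‖u t x‖ ^ 2 * φ t x)) := by
          congr 1
          rw [ofReal_integral_eq_lintegral_ofReal hint
            (Eventually.of_forall fun x => mul_nonneg (sq_nonneg _) (hφ0 _ _)), ← lintegral_const_mul' _ _
            ENNReal.ofReal_ne_top]
          refine lintegral_congr fun x => ?_
          rw [ENNReal.ofReal_mul (by positivity), ENNReal.ofReal_mul (sq_nonneg _),
            ENNReal.ofReal_pow (norm_nonneg _), ofReal_norm]
          ring
      _ ≤ (ENNReal.ofReal r)⁻¹ * (ENNReal.ofReal (C₁ * r) * ENNReal.ofReal M) := by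
          gcongr
      _ = ENNReal.ofReal (C₁ * M) := by
          rw [ENNReal.ofReal_mul hC0, mul_comm (ENNReal.ofReal C₁) (ENNReal.ofReal r), mul_assoc,
            ← mul_assoc, ENNReal.inv_mul_cancel (ENNReal.ofReal_pos.2 hr).ne' ENNReal.ofReal_ne_top, one_mul,
            ← ENNReal.ofReal_mul hC0]
  ------------------------------------------------------------------
  -- (E2) the dissipation: `cknE r z G ≤ C₁ M / 2`
  ------------------------------------------------------------------
  set Ss : Set (ℝ × EuclideanSpace ℝ (Fin 3)) := {w | w.1 < z.1} with hSs
  have hDs : ∫ w in Ss, frobeniusNormSq (G w.1 w.2) * φ w.1 w.2 ≤ M / 2 := by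
    set δ : ℕ → ℝ := fun j => 1 / ((j : ℝ) + 1) with hδ
    have hδ0 : ∀ j, 0 < δ j := fun j => by positivity
    set A : ℕ → Set (ℝ × EuclideanSpace ℝ (Fin 3)) := fun j => {w | w.1 < z.1 - δ j} with hA_def
    have hAm : ∀ j, MeasurableSet (A j) := fun j => measurableSet_lt measurable_fst measurable_const
    have hmono : Monotone A := by
      intro i j hij w hw
      have h : δ j ≤ δ i := by
        simp only [hδ]
        exact one_div_le_one_div_of_le (by positivity) (by exact_mod_cast Nat.add_le_add_right hij 1)
      show w.1 < z.1 - δ j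
      exact lt_of_lt_of_le hw (by linarith)
    have hUnion : (⋃ j, A j) = Ss := by
      ext w
      simp only [mem_iUnion, hA_def, hSs, mem_setOf_eq]
      constructor
      · rintro ⟨j, hj⟩; linarith [hδ0 j]
      · intro hw
        obtain ⟨j, hj⟩ := exists_nat_one_div_lt (show 0 < z.1 - w.1 by linarith)
        exact ⟨j, by simp only [hδ]; linarith⟩
    have hfi : IntegrableOn (fun w : ℝ × EuclideanSpace ℝ (Fin 3) => frobeniusNormSq (G w.1 w.2) * φ w.1 w.2)
        (⋃ j, A j) volume := by rw [hUnion]; exact hIGφ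
    have htends := tendsto_setIntegral_of_monotone hAm hmono hfi
    rw [hUnion] at htends
    refine le_of_tendsto' htends fun j => ?_
    have hex : ∃ t ∈ Ioo (z.1 - δ j) z.1,
        ∫ w in {w : ℝ × EuclideanSpace ℝ (Fin 3) | w.1 < t}, frobeniusNormSq (G w.1 w.2) * φ w.1 w.2 ≤ M / 2 := by
      by_contra hne
      push Not at hne
      have hsub : Ioo (z.1 - δ j) z.1 ⊆ {t | ¬(t < z.1 →
          (∫ x, ‖u t x‖ ^ 2 * φ t x) ≤ M ∧
            ∫ w in {w : ℝ × EuclideanSpace ℝ (Fin 3) | w.1 < t}, frobeniusNormSq (G w.1 w.2) * φ w.1 w.2 ≤ M / 2)} := by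
        intro t ht hgood'
        exact (not_le.2 (hne t ht)) (hgood' ht.2).2
      have h0 : volume (Ioo (z.1 - δ j) z.1) = 0 := measure_mono_null hsub (ae_iff.1 hgood)
      rw [Real.volume_Ioo] at h0
      have : (0 : ℝ≥0∞) < ENNReal.ofReal (z.1 - (z.1 - δ j)) := ENNReal.ofReal_pos.2 (by linarith [hδ0 j])
      exact this.ne' h0
    obtain ⟨t, htI, htb⟩ := hex
    calc ∫ w in A j, frobeniusNormSq (G w.1 w.2) * φ w.1 w.2
        ≤ ∫ w in {w : ℝ × EuclideanSpace ℝ (Fin 3) | w.1 < t}, frobeniusNormSq (G w.1 w.2) * φ w.1 w.2 := by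
          refine setIntegral_mono_set (hIGφ.mono_set fun w hw => lt_trans hw htI.2)
            (Eventually.of_forall fun w => hGφ0 w) (LE.le.eventuallyLE (show A j ≤ {w : ℝ × EuclideanSpace ℝ (Fin 3) | w.1 < t} from fun w hw => ?_))
          exact lt_trans hw htI.1
      _ ≤ M / 2 := htb
  have hE2 : cknE r z G ≤ ENNReal.ofReal (C₁ * M / 2) := by
    rw [cknE]
    have hQm : MeasurableSet (parabolicCylinder r z) := (isOpen_parabolicCylinder r z).measurableSet
    have hsubS : parabolicCylinder r z ⊆ Ss := fun w hw => ((mem_parabolicCylinder.1 hw).1).2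
    calc (ENNReal.ofReal r)⁻¹ * ∫⁻ w in parabolicCylinder r z, ENNReal.ofReal (frobeniusNormSq (G w.1 w.2))
        ≤ (ENNReal.ofReal r)⁻¹ * ∫⁻ w in parabolicCylinder r z,
            ENNReal.ofReal (C₁ * r) * ENNReal.ofReal (frobeniusNormSq (G w.1 w.2) * φ w.1 w.2) := by
          refine mul_le_mul_right (setLIntegral_mono' hQm fun w hw => ?_) _
          rw [← ENNReal.ofReal_mul (by positivity)]
          refine ENNReal.ofReal_le_ofReal ?_
          have h := (hcore w hw).1
          have hCr : 0 < C₁ * r := by positivity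
          have hG0 := frobeniusNormSq_nonneg (G w.1 w.2)
          calc frobeniusNormSq (G w.1 w.2) = (C₁ * r * (C₁⁻¹ * r⁻¹)) * frobeniusNormSq (G w.1 w.2) := by
                field_simp
            _ ≤ (C₁ * r * φ w.1 w.2) * frobeniusNormSq (G w.1 w.2) :=
                mul_le_mul_of_nonneg_right (mul_le_mul_of_nonneg_left h hCr.le) hG0
            _ = C₁ * r * (frobeniusNormSq (G w.1 w.2) * φ w.1 w.2) := by ring
      _ ≤ (ENNReal.ofReal r)⁻¹ * ∫⁻ w in Ss,
            ENNReal.ofReal (C₁ * r) * ENNReal.ofReal (frobeniusNormSq (G w.1 w.2) * φ w.1 w.2) :=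
          mul_le_mul_right (lintegral_mono_set hsubS) _
      _ = (ENNReal.ofReal r)⁻¹ * (ENNReal.ofReal (C₁ * r) *
            ENNReal.ofReal (∫ w in Ss, frobeniusNormSq (G w.1 w.2) * φ w.1 w.2)) := by
          rw [lintegral_const_mul' _ _ ENNReal.ofReal_ne_top,
            ofReal_integral_eq_lintegral_ofReal hIGφ (Eventually.of_forall fun w => hGφ0 w)]
      _ ≤ (ENNReal.ofReal r)⁻¹ * (ENNReal.ofReal (C₁ * r) * ENNReal.ofReal (M / 2)) := by
          gcongr
      _ = ENNReal.ofReal (C₁ * M / 2) := by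
          rw [ENNReal.ofReal_mul hC0, mul_comm (ENNReal.ofReal C₁) (ENNReal.ofReal r), mul_assoc,
            ← mul_assoc, ENNReal.inv_mul_cancel (ENNReal.ofReal_pos.2 hr).ne' ENNReal.ofReal_ne_top, one_mul,
            ← ENNReal.ofReal_mul hC0]
          congr 1; ring
  ------------------------------------------------------------------
  -- (B'_{n+1})
  ------------------------------------------------------------------
  calc cknAEss r z u + cknE r z G ≤ ENNReal.ofReal (C₁ * M) + ENNReal.ofReal (C₁ * M / 2) := add_le_add hE1 hE2
    _ = ENNReal.ofReal (C₁ ^ 2 * (3 / 2) * (15 + 2 * c') * ε₀ ^ (2 / 3 : ℝ)) := by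
        rw [← ENNReal.ofReal_add (by positivity) (by positivity)]
        congr 1
        rw [hM_def]
        ring

/-- **Step 2 of the initial-time induction holds**, by `initialStep2` and the proved Lemma 15.11
(`RRS2016.lemma15_11_holds`). [cite: RobinsonRodrigoSadowski2016, proof of Thm. 15.3, Step 2, pp. 221–223] -/
theorem initialStep2_holds :
    ∃ CB : ℝ, 1 ≤ CB ∧
      ∀ (z₀ : ℝ × EuclideanSpace ℝ (Fin 3))
        (u₀ : EuclideanSpace ℝ (Fin 3) → EuclideanSpace ℝ (Fin 3))
        (u : ℝ → EuclideanSpace ℝ (Fin 3) → EuclideanSpace ℝ (Fin 3))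
        (p : ℝ → EuclideanSpace ℝ (Fin 3) → ℝ)
        (G : ℝ → EuclideanSpace ℝ (Fin 3) → EuclideanSpace ℝ (Fin 3) →L[ℝ] EuclideanSpace ℝ (Fin 3)),
        HasWeakSpatialGradientOn (parabolicCylinderOpens 1 z₀) u G →
        ∫⁻ w in parabolicCylinder 1 z₀, ENNReal.ofReal (frobeniusNormSq (G w.1 w.2)) < ∞ →
        LocallyIntegrableOn (uncurry p) (parabolicCylinder 1 z₀) volume →
        ∫⁻ w in parabolicCylinder 1 z₀, ‖p w.1 w.2‖ₑ ^ (3 / 2 : ℝ) < ∞ →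
        (∀ θ : ℝ → EuclideanSpace ℝ (Fin 3) → ℝ, IsSpaceTimeTestOn (parabolicCylinderOpens 1 z₀) θ →
          ∫ w in parabolicCylinder 1 z₀, ⟪u w.1 w.2, gradient (θ w.1) w.2⟫ = 0) →
        (∀ φ : ℝ → EuclideanSpace ℝ (Fin 3) → ℝ, IsSpaceTimeTestOn (parabolicCylinderOpens 1 z₀) φ →
          (∀ t x, 0 ≤ φ t x) →
          2 * 1 * ∫ t, ∫ x, frobeniusNormSq (G t x) * φ t x ≤
            (∫ x, ‖u₀ x‖ ^ 2 * φ 0 x) +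
            ∫ t, ∫ x, (‖u t x‖ ^ 2 * (timeDeriv φ t x + 1 * Δ (φ t) x) +
              (‖u t x‖ ^ 2 + 2 * p t x) * ⟪u t x, gradient (φ t) x⟫)) →
        ∀ ε₀ : ℝ, 0 < ε₀ → Small ε₀ u p z₀ →
          ∀ z ∈ parabolicCylinder (1 / 2) z₀,
            (∀ ρ : ℝ, 0 < ρ → ρ ≤ 1 →
              ∫⁻ x in ball z.2 ρ, ‖u₀ x‖ₑ ^ 2 ≤ ENNReal.ofReal (ε₀ ^ (2 / 3 : ℝ) * ρ)) →
            ∀ n : ℕ, 1 ≤ n →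
              (∀ k : ℕ, 1 ≤ k → k ≤ n →
                cknC (rad k) z u + cknDOsc (rad k) z p ≤ ENNReal.ofReal (ε₀ ^ (2 / 3 : ℝ))) →
              cknAEss (rad (n + 1)) z u + cknE (rad (n + 1)) z G ≤
                ENNReal.ofReal (CB * ε₀ ^ (2 / 3 : ℝ)) :=
  initialStep2 lemma15_11_holds

end Final

end BarkerPrange2020

end Literature.Analysis.FluidPDE

end
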